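import Literature.Computability.FineGrained.CliqueETHGroupingReduction
import HarnessLib

/-!
# Sparse `k`-SAT on the word RAM: the deduplication wrapper (program and verification)

Support for the named fact `Literature.Computability.FineGrained.kSATInRAMTime_of_sparseKSATInRAMTime`
(`CliqueETH.lean`; Impagliazzo–Paturi–Zane, JCSS 63 (2001), Cor. 1–2 read on the word RAM:
word-RAM algorithms for *sparse* `k`-SAT of every density and every exponent give word-RAM
algorithms for `k`-SAT of every exponent). The tree proves that fact by a detour through
multi-stack Turing machines (`CliqueETHMachineModel`, `CliqueETHTMBridge`, `SETHHardnessProofs`),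
whose entrance `sparseKSATInExpTime_of_liberalSparseKSATInRAMTime_holds` wants the *liberal*
form `LiberalSparseKSATInRAMTime` of the hypothesis: a program deciding *every* clause list of
width `≤ k` (repetitions allowed) at *every* admissible word size, whereas `SparseKSATInRAMTime`
only speaks about `List.Nodup` instances of `kSATProblem k` run at exactly the word size
`k' · (n + inputWidth x)`. This file builds and verifies the word-RAM program closing that gap
(`CliqueETHSparseLiberal.lean` does the word-size and time analysis):

* **the program** (`DedupWrap.pre`, `DedupWrap.wrapper`), structured word-RAM code
  (`SProg`, verified in the logic `SProg.Achieves`) around one emulated run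
  (`SProg.withSubrun`) of the hypothetical sparse-`k`-SAT program `M`: relocate the input
  `x = encodeCNFWords φ`; **deduplicate** the clause list by one forward scan (a clause is
  emitted iff no later clause equals it — block comparison word by word — so the emitted list is
  `List.dedup φ`), writing the blocks of `y = encodeCNFWords (dedup φ)` directly into the emulated
  cells; write the header `n, |dedup φ|, |y|`; compute the input width of `y` in closed form
  (`inputWidth_encodeCNFWords`: the binary length of `max |y| (2n - 1)`, by the halving loop
  `CliqueRed.sizeLoop`), the emulated word size `ws = kM · (n + inputWidth y)` and the emulator's
  environment; clear the scratch; after the emulated run, `CliqueRed.post` copies the answer bit;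
* **the mathematics of deduplication** (`cntD`, `dedup_eq_take_append`, `numVars_dedup`,
  `satisfiable_dedup_iff`, `inputWidth_dedup_le`, `clause_eq_iff_words`);
* **ghost parameters** (`DedupWrap.Params`: `x, Lx, X, m, n, ψ = dedup φ, y, Ly, Bv, cnt, wv, σ,
  ws, Pw, V, Sv, env`), the word-size requirement `Params.Fits W`, the staged data `preData` and
  the final memory `finMem`;
* **verification** loop by loop (`cmp_loop`, `scanBody_spec`, `scan_loop`, `copy_loop`,
  `copyBlock_spec`, `outerBody_spec`, `dedupLoop_spec`, `setupA_spec`, `header_spec`,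
  `widthPart_spec`, `setupE_spec`), **`Params.pre_spec`** (the build ends in `finMem` within
  `Tpre` steps), the emulator's side conditions (`envOK`, `tinv_finMem`, `agree_finMem`), the
  read-out (`post_spec`) and **`Params.wrapper_outputsWithin`**: if `M` outputs `[bit]` on `y` at
  word size `ws` within `T` steps then the wrapper outputs `[bit]` on `x` within
  `Tpre + 38 T + 4` steps.

## References

* R. Impagliazzo, R. Paturi, F. Zane, *Which problems have strongly exponential complexity?*,
  JCSS 63 (2001) 512–530, §2: Thm. 1, Cor. 1 (sparsification), Cor. 2 (`k`-SAT with parameter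
  `n` SERF-reduces to `k`-SAT with parameter `m`).
* V. Vassilevska Williams, *On some fine-grained questions in algorithms and complexity*,
  Proc. ICM 2018, §2 (the word RAM; algorithms calling an algorithm for another problem).
* T. Nipkow, G. Klein, *Concrete Semantics with Isabelle/HOL*, Springer 2014, §12 (verification
  of `WHILE` programs by invariants).
-/

namespace Literature.Computability.FineGrained

open Cryptography Cryptography.WordRAM Complexity Cryptography.WordRAM.SProg

namespace DedupWrap

/-! ### Lists: `foldr max`, `dedup` -/

/-- `foldr max 0` is bounded by any common bound of the entries. [folklore] -/
theorem foldr_max_le {l : List ℕ} {b B : ℕ} (hb : b ≤ B) (h : ∀ x ∈ l, x ≤ B) :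
    l.foldr max b ≤ B := by
  induction l with
  | nil => exact hb
  | cons a l ih =>
    rw [List.foldr_cons]
    exact max_le (h a (by simp)) (ih fun x hx => h x (by simp [hx]))

/-- `foldr max b` is attained or is the default. [folklore] -/
theorem foldr_max_mem_or {l : List ℕ} {b : ℕ} : l.foldr max b = b ∨ l.foldr max b ∈ l := by
  induction l with
  | nil => exact Or.inl rfl
  | cons a l ih =>
    rw [List.foldr_cons]
    rcases le_total a (l.foldr max b) with h | h
    · rw [max_eq_right h]
      rcases ih with h' | h'
      · exact Or.inl h'
      · exact Or.inr (List.mem_cons_of_mem _ h')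
    · rw [max_eq_left h]; exact Or.inr (by simp)

/-- The number of surviving clauses after the first `i` clauses have been processed by the
forward-scanning deduplication (a clause survives iff it does not occur later). [folklore] -/
def cntD {α : Type*} [DecidableEq α] (φ : List α) (i : ℕ) : ℕ :=
  φ.dedup.length - (φ.drop i).dedup.length

/-- **Prefix decomposition of `List.dedup`**: after `i` clauses, `dedup φ` is the already
emitted prefix followed by the deduplication of the rest. [folklore] -/
theorem dedup_eq_take_append {α : Type*} [DecidableEq α] (φ : List α) :
    ∀ i, i ≤ φ.length → φ.dedup = φ.dedup.take (cntD φ i) ++ (φ.drop i).dedup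
  | 0, _ => by simp [cntD]
  | i + 1, hi => by
    have ih := dedup_eq_take_append φ i (by omega)
    have hdrop : φ.drop i = φ[i] :: φ.drop (i + 1) := List.drop_eq_getElem_cons (by omega)
    by_cases hmem : φ[i] ∈ φ.drop (i + 1)
    · have e : (φ.drop i).dedup = (φ.drop (i + 1)).dedup := by
        rw [hdrop, List.dedup_cons_of_mem hmem]
      have ec : cntD φ (i + 1) = cntD φ i := by unfold cntD; rw [e]
      rw [ec, ← e]; exact ih
    · have e : (φ.drop i).dedup = φ[i] :: (φ.drop (i + 1)).dedup := by
        rw [hdrop, List.dedup_cons_of_notMem hmem]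
      have hlen : φ.dedup.length = cntD φ i + ((φ.drop (i + 1)).dedup.length + 1) := by
        have := congrArg List.length ih
        rw [List.length_append, List.length_take, e, List.length_cons] at this
        omega
      have ec : cntD φ (i + 1) = cntD φ i + 1 := by unfold cntD at hlen ⊢; omega
      rw [ec]
      conv_lhs => rw [ih, e]
      rw [List.take_add_one]
      have hget : φ.dedup[cntD φ i]? = some φ[i] := by
        rw [ih, List.getElem?_append_right (by simp), List.length_take, e]
        simp [Nat.min_eq_left (show cntD φ i ≤ φ.dedup.length by omega)]
      rw [hget]; simp

/-- No clause processed: nothing emitted. [folklore] -/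
theorem cntD_zero {α : Type*} [DecidableEq α] (φ : List α) : cntD φ 0 = 0 := by simp [cntD]

/-- All clauses processed: everything emitted. [folklore] -/
theorem cntD_length {α : Type*} [DecidableEq α] (φ : List α) : cntD φ φ.length = φ.dedup.length := by
  simp [cntD]

/-- A clause occurring later is skipped. [folklore] -/
theorem cntD_succ_of_mem {α : Type*} [DecidableEq α] (φ : List α) {i : ℕ} (hi : i < φ.length)
    (h : φ[i] ∈ φ.drop (i + 1)) : cntD φ (i + 1) = cntD φ i := by
  unfold cntD
  rw [List.drop_eq_getElem_cons hi, List.dedup_cons_of_mem h]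

/-- A clause not occurring later is emitted: it is the next entry of `dedup φ`. [folklore] -/
theorem cntD_succ_of_not_mem {α : Type*} [DecidableEq α] (φ : List α) {i : ℕ} (hi : i < φ.length)
    (h : φ[i] ∉ φ.drop (i + 1)) :
    cntD φ (i + 1) = cntD φ i + 1 ∧ cntD φ i < φ.dedup.length ∧
      φ.dedup[cntD φ i]? = some φ[i] := by
  have ih := dedup_eq_take_append φ i hi.le
  have e : (φ.drop i).dedup = φ[i] :: (φ.drop (i + 1)).dedup := by
    rw [List.drop_eq_getElem_cons hi, List.dedup_cons_of_notMem h]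
  have hlen : φ.dedup.length = cntD φ i + ((φ.drop (i + 1)).dedup.length + 1) := by
    have := congrArg List.length ih
    rw [List.length_append, List.length_take, e, List.length_cons] at this
    omega
  refine ⟨by unfold cntD at hlen ⊢; omega, by omega, ?_⟩
  rw [ih, List.getElem?_append_right (by simp), List.length_take, e]
  simp [Nat.min_eq_left (show cntD φ i ≤ φ.dedup.length by omega)]

/-- `cntD` is at most the number of processed clauses' survivors, hence `≤ |dedup φ|`. [folklore] -/
theorem cntD_le {α : Type*} [DecidableEq α] (φ : List α) (i : ℕ) : cntD φ i ≤ φ.dedup.length :=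
  Nat.sub_le _ _

/-! ### CNFs under deduplication -/

/-- `numVars` is monotone under inclusion of the occurring literals. [folklore] -/
theorem numVars_le_of_forall {φ ψ : CNF ℕ} (h : ∀ c ∈ φ, ∀ l ∈ c, ∃ c' ∈ ψ, l ∈ c') :
    CNF.numVars φ ≤ CNF.numVars ψ := by
  unfold CNF.numVars
  refine foldr_max_le (Nat.zero_le _) fun x hx => ?_
  obtain ⟨l, hl, rfl⟩ := List.mem_map.1 hx
  obtain ⟨c, hc, hlc⟩ := List.mem_flatten.1 hl
  obtain ⟨c', hc', hlc'⟩ := h c hc l hlc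
  have hm : l.1 + 1 ∈ ψ.flatten.map (fun l => l.1 + 1) :=
    List.mem_map.2 ⟨l, List.mem_flatten.2 ⟨c', hc', hlc'⟩, rfl⟩
  exact CliqueRed.le_foldr_max_of_mem hm 0

/-- Deduplication keeps the number of variables. [folklore] -/
theorem numVars_dedup (φ : CNF ℕ) : CNF.numVars φ.dedup = CNF.numVars φ :=
  le_antisymm (numVars_le_of_forall fun c hc _ hl => ⟨c, List.mem_dedup.1 hc, hl⟩)
    (numVars_le_of_forall fun c hc _ hl => ⟨c, List.mem_dedup.2 hc, hl⟩)

/-- Deduplication keeps satisfiability. [folklore] -/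
theorem satisfiable_dedup_iff (φ : CNF ℕ) : CNF.Satisfiable φ.dedup ↔ CNF.Satisfiable φ := by
  simp only [CNF.Satisfiable, CNF.eval_eq_true_iff, List.mem_dedup]

/-- Deduplication keeps the width bound. [folklore] -/
theorem isWidthLE_dedup {k : ℕ} {φ : CNF ℕ} (h : φ.IsWidthLE k) : CNF.IsWidthLE k φ.dedup :=
  fun c hc => h c (List.mem_dedup.1 hc)

/-- Deduplication does not increase the number of clauses. [folklore] -/
theorem numClauses_dedup_le (φ : CNF ℕ) : CNF.numClauses φ.dedup ≤ CNF.numClauses φ :=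
  (List.dedup_sublist φ).length_le

/-- Deduplication does not increase the total size. [folklore] -/
theorem size_dedup_le (φ : CNF ℕ) : CNF.size φ.dedup ≤ CNF.size φ :=
  ((List.dedup_sublist φ).map List.length).sum_le_sum (fun _ _ => Nat.zero_le _)

/-- Deduplication does not lengthen the word encoding. [folklore] -/
theorem length_encodeCNFWords_dedup_le (φ : CNF ℕ) :
    (encodeCNFWords φ.dedup).length ≤ (encodeCNFWords φ).length := by
  rw [length_encodeCNFWords_eq, length_encodeCNFWords_eq]
  have := numClauses_dedup_le φ; have := size_dedup_le φ; omega

/-! ### The input width of a CNF encoding in closed form -/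

/-- `Nat.size` of a maximum. [folklore] -/
theorem size_max (a b : ℕ) : Nat.size (max a b) = max (Nat.size a) (Nat.size b) := by
  rcases le_total a b with h | h
  · rw [max_eq_right h, max_eq_right (Nat.size_le_size h)]
  · rw [max_eq_left h, max_eq_left (Nat.size_le_size h)]

/-- `2n - 2` and `2n - 1` have the same binary length for `n ≥ 2`. [folklore] -/
theorem size_two_mul_sub (n : ℕ) (hn : 2 ≤ n) : Nat.size (2 * n - 2) = Nat.size (2 * n - 1) := by
  have e1 : 2 * n - 2 = Nat.bit false (n - 1) := by simp [Nat.bit]; omega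
  have e2 : 2 * n - 1 = Nat.bit true (n - 1) := by simp [Nat.bit]; omega
  rw [e1, e2, Nat.size_bit (by simp [Nat.bit]; omega), Nat.size_bit (by simp [Nat.bit])]

/-- Every word of `encodeCNFWords ψ` is at most `max |encodeCNFWords ψ| (2 · numVars ψ - 1)`.
[folklore] -/
theorem encodeCNFWords_le (ψ : CNF ℕ) {v : ℕ} (hv : v ∈ encodeCNFWords ψ) :
    v ≤ max (encodeCNFWords ψ).length (2 * CNF.numVars ψ - 1) := by
  have hlen := length_encodeCNFWords_eq ψ
  rw [encodeCNFWords_eq] at hv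
  simp only [List.mem_cons, List.mem_flatMap] at hv
  rcases hv with rfl | rfl | ⟨c, hc, hv⟩
  · exact le_max_of_le_right (by omega)
  · exact le_max_of_le_left (by rw [hlen, CNF.numClauses]; omega)
  · simp only [clauseWords, List.mem_cons, List.mem_map] at hv
    rcases hv with rfl | ⟨l, hl, rfl⟩
    · refine le_max_of_le_left ?_
      have : c.length ≤ CNF.size ψ := by
        unfold CNF.size; exact List.le_sum_of_mem (List.mem_map.2 ⟨c, hc, rfl⟩)
      omega
    · refine le_max_of_le_right ?_
      have := CliqueRed.lt_numVars_of_mem hc hl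
      have hb : l.2.toNat ≤ 1 := Bool.toNat_le _
      unfold litCode; omega

/-- If `numVars ψ = n ≥ 1`, some literal on the variable `n - 1` occurs, so some word of the
encoding is `≥ 2n - 2`. [folklore] -/
theorem exists_word_ge (ψ : CNF ℕ) (hn : 1 ≤ CNF.numVars ψ) :
    ∃ v ∈ encodeCNFWords ψ, 2 * CNF.numVars ψ - 2 ≤ v := by
  have h := foldr_max_mem_or (l := ψ.flatten.map fun l => l.1 + 1) (b := 0)
  rw [← CNF.numVars] at h
  rcases h with h | h
  · omega
  · obtain ⟨l, hl, hl1⟩ := List.mem_map.1 h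
    obtain ⟨c, hc, hlc⟩ := List.mem_flatten.1 hl
    refine ⟨litCode l, ?_, by unfold litCode; omega⟩
    rw [encodeCNFWords_eq]
    refine List.mem_cons_of_mem _ (List.mem_cons_of_mem _ (List.mem_flatMap.2 ⟨c, hc, ?_⟩))
    exact List.mem_cons_of_mem _ (List.mem_map.2 ⟨l, hlc, rfl⟩)

/-- **The input width of a CNF encoding**: `inputWidth (encodeCNFWords ψ)` is the binary length
of `max |encodeCNFWords ψ| (2 · numVars ψ - 1)`. [folklore] -/
theorem inputWidth_encodeCNFWords (ψ : CNF ℕ) :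
    inputWidth (encodeCNFWords ψ) =
      Nat.size (max (encodeCNFWords ψ).length (2 * CNF.numVars ψ - 1)) := by
  set y := encodeCNFWords ψ with hy
  set n := CNF.numVars ψ with hn
  have hlen : 2 ≤ y.length := by rw [hy, length_encodeCNFWords_eq]; omega
  unfold inputWidth
  apply le_antisymm
  · refine Nat.size_le_size (max_le (le_max_left _ _) (foldr_max_le ?_ fun v hv => ?_))
    · exact le_max_of_le_left (by omega)
    · exact encodeCNFWords_le ψ hv
  · rw [size_max, size_max]
    refine max_le (le_max_left _ _) ?_
    rcases Nat.lt_or_ge n 2 with h2 | h2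
    · -- `n ≤ 1`: `2n - 1 ≤ 1 ≤ |y|`
      refine le_max_of_le_left (Nat.size_le_size ?_); omega
    · obtain ⟨v, hv, hge⟩ := exists_word_ge ψ (by omega)
      have hF : 2 * n - 2 ≤ y.foldr max 1 := hge.trans (CliqueRed.le_foldr_max_of_mem hv 1)
      refine le_max_of_le_right ?_
      rw [← size_two_mul_sub n h2]
      exact Nat.size_le_size hF

/-- The input width does not grow under deduplication. [folklore] -/
theorem inputWidth_dedup_le (φ : CNF ℕ) :
    inputWidth (encodeCNFWords φ.dedup) ≤ inputWidth (encodeCNFWords φ) := by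
  rw [inputWidth_encodeCNFWords, inputWidth_encodeCNFWords, numVars_dedup]
  exact Nat.size_le_size (max_le_max (length_encodeCNFWords_dedup_le φ) le_rfl)

/-! ### Clause blocks: comparison of two blocks of the encoding -/

/-- `litCode` is injective. [folklore] -/
theorem litCode_injective : Function.Injective litCode := by
  rintro ⟨v, b⟩ ⟨v', b'⟩ h
  unfold litCode at h
  cases b <;> cases b' <;> simp at h ⊢ <;> omega

/-- **Two clause blocks agree iff the clauses are equal**: equal length words and equal literal
words. [folklore] -/
theorem clause_eq_iff_words (φ : CNF ℕ) {i j : ℕ} (hi : i < φ.length) (hj : j < φ.length) :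
    φ[i] = φ[j] ↔ (φ[i].length = φ[j].length ∧ ∀ t, t < φ[i].length →
      (encodeCNFWords φ).getD (clauseStart φ i + 1 + t) 0 =
        (encodeCNFWords φ).getD (clauseStart φ j + 1 + t) 0) := by
  constructor
  · intro h
    refine ⟨by rw [h], fun t ht => ?_⟩
    rw [List.getD_eq_getElem?_getD, List.getD_eq_getElem?_getD,
      encodeCNFWords_getElem?_clauseStart_succ φ hi ht,
      encodeCNFWords_getElem?_clauseStart_succ φ hj (by rw [← h]; exact ht)]
    simp [h]
  · rintro ⟨hlen, hw⟩
    apply List.ext_getElem hlen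
    intro t ht ht'
    have := hw t ht
    rw [List.getD_eq_getElem?_getD, List.getD_eq_getElem?_getD,
      encodeCNFWords_getElem?_clauseStart_succ φ hi ht,
      encodeCNFWords_getElem?_clauseStart_succ φ hj ht'] at this
    exact litCode_injective (by simpa using this)


/-! ### Operand shorthands -/

/-- Direct operand: register / cell `i`. [folklore] -/
abbrev r (i : ℕ) : Operand := .dir i
/-- Indirect operand through cell `i`. [folklore] -/
abbrev pt (i : ℕ) : Operand := .ind i
/-- Immediate operand. [folklore] -/
abbrev im (c : ℕ) : Operand := .imm c

/-! ### The program

Register map (cells `< 100`): `0 = X` (base of the relocated input, `x[j]` in cell `X + j`; set by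
`relocate`), `2 =` remaining input clauses, `3 = p` (address of the current input clause block),
`4 = q` (address of the next output block), `5 = cnt` (output clauses so far), `6 = len` (length
of the current clause), `7 = s` (scan address), `8 =` remaining scan steps, `9 = found`; the
emulator's layout `10 = Bv`, `11 = Sv`, `12 = Gv (= 0)`, `13 = Pw = 2^ws`, temporaries
`14–16`; `17` post; scratch `20–26` (comparison and copy), `21, 22` (size loop), `30, 31`
(width), `22–24` (environment). -/

/-- Setup: `r2 := m`, `p := X + 2`, `Bv := X + Lx`, `q := Bv + 3`, `cnt := 0`. [folklore] -/
def setupA : SProg := block [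
  (.add, r 20, r 0, im 1), (.band, r 2, pt 20, pt 20),
  (.add, r 3, r 0, im 2),
  (.sub, r 10, r 0, im 101), (.add, r 10, r 10, r 0),
  (.add, r 4, r 10, im 3),
  (.band, r 5, im 0, im 0)]

/-- Comparison, one word: `eq := eq ∧ [x[p + 1 + t] = mem[s + 1 + t]]`, advance `t`. [folklore] -/
def cmpBody : SProg := block [
  (.add, r 25, r 3, r 23), (.add, r 25, r 25, im 1), (.band, r 25, pt 25, pt 25),
  (.add, r 26, r 7, r 23), (.add, r 26, r 26, im 1), (.band, r 26, pt 26, pt 26),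
  (.eq, r 25, r 25, r 26), (.band, r 21, r 21, r 25),
  (.add, r 23, r 23, im 1), (.sub, r 24, r 24, im 1)]

/-- Scan, one later clause at `s`: compare it with the current clause (lengths, then words),
OR the result into `found`, advance `s`. [folklore] -/
def scanBody : SProg := seqs [
  block [(.band, r 20, pt 7, pt 7), (.eq, r 21, r 6, r 20), (.band, r 23, im 0, im 0),
    (.band, r 24, r 6, r 6)],
  whilenz (r 24) cmpBody,
  block [(.eq, r 25, r 21, im 0), (.eq, r 26, r 9, im 0), (.band, r 25, r 25, r 26),
    (.lt, r 9, r 25, im 1), (.add, r 7, r 7, r 20), (.add, r 7, r 7, im 1), (.sub, r 8, r 8, im 1)]]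

/-- Copy, one word: `mem[q + 1 + t] := x[p + 1 + t]`, advance `t`. [folklore] -/
def copyBody : SProg := block [
  (.add, r 25, r 3, r 23), (.add, r 25, r 25, im 1), (.band, r 25, pt 25, pt 25),
  (.add, r 26, r 4, r 23), (.add, r 26, r 26, im 1), (.band, pt 26, r 25, r 25),
  (.add, r 23, r 23, im 1), (.sub, r 24, r 24, im 1)]

/-- Copy the current clause block to `q`: its length, its words; advance `q`, `cnt`. [folklore] -/
def copyBlock : SProg := seqs [
  block [(.band, pt 4, r 6, r 6), (.band, r 23, im 0, im 0), (.band, r 24, r 6, r 6)],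
  whilenz (r 24) copyBody,
  block [(.add, r 4, r 4, r 6), (.add, r 4, r 4, im 1), (.add, r 5, r 5, im 1)]]

/-- One input clause: read its length, scan the later clauses for a copy of it, emit it if none
was found, advance `p`. [folklore] -/
def outerBody : SProg := seqs [
  block [(.band, r 6, pt 3, pt 3), (.add, r 7, r 3, r 6), (.add, r 7, r 7, im 1),
    (.sub, r 8, r 2, im 1), (.band, r 9, im 0, im 0)],
  whilenz (r 8) scanBody,
  ifz (r 9) copyBlock skip,
  block [(.add, r 3, r 3, r 6), (.add, r 3, r 3, im 1), (.sub, r 2, r 2, im 1)]]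

/-- **Deduplication**: one pass over the input clauses (a clause is emitted iff it does not occur
later, so the emitted list is `List.dedup` of the clause list). [folklore] -/
def dedupLoop : SProg := whilenz (r 2) outerBody

/-- The header of the emulated input: `y[0] := n`, `y[1] := cnt`, and `|y|` in emulated cell `0`
(also left in `r21`). [folklore] -/
def header : SProg := block [
  (.add, r 20, r 10, im 1), (.band, pt 20, pt 0, pt 0),
  (.add, r 20, r 10, im 2), (.band, pt 20, r 5, r 5),
  (.sub, r 21, r 4, r 10), (.sub, r 21, r 21, im 1),
  (.band, pt 10, r 21, r 21)]

/-- The input width of the emulated input: `r21 := max |y| (2n - 1)`, then `r22 := size r21` by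
the halving loop of the clique reduction. [folklore] -/
def widthPart : SProg := seqs [
  block [(.band, r 30, pt 0, pt 0), (.add, r 30, r 30, r 30), (.lt, r 31, im 0, r 30),
    (.sub, r 30, r 30, r 31), (.lt, r 31, r 21, r 30)],
  ifz (r 31) skip (block [(.band, r 21, r 30, r 30)]),
  block [(.band, r 22, im 0, im 0)],
  CliqueRed.sizeLoop]

/-- The environment: `ws := kM · (n + size)`, `Pw := 2^ws`, `V := max (Pw - 1) cM`,
`Sv := Bv + V + 1`, `Gv := 0`. [folklore] -/
def setupE (kM cM : ℕ) : SProg := seqs [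
  block [(.add, r 22, pt 0, r 22), (.mul, r 22, r 22, im kM), (.shl, r 13, im 1, r 22),
    (.sub, r 23, r 13, im 1), (.lt, r 24, r 23, im cM)],
  ifz (r 24) skip (block [(.band, r 23, im cM, im cM)]),
  block [(.add, r 11, r 10, r 23), (.add, r 11, r 11, im 1), (.band, r 12, im 0, im 0)]]

/-- **The build**: relocate the input, deduplicate the clause list into the emulated cells, write
the header, compute the emulated word size and the environment, clear the scratch. [folklore] -/
def pre (kM cM : ℕ) : SProg := seqs [
  relocate, setupA, dedupLoop, header, widthPart, setupE kM cM, CliqueRed.clearRegs]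

/-- **The wrapper program**: the deduplicated clause list decided by one emulated run of the
sparse-`k`-SAT program `M` at its own word size. [folklore] -/
def wrapper (M : Program) (kM : ℕ) : Program :=
  withSubrun (pre kM M.maxConst) CliqueRed.lay M CliqueRed.post

/-- The build is query-free. [folklore] -/
theorem pre_queryFree (kM cM : ℕ) : (pre kM cM).QueryFree := by
  refine seqs_queryFree ?_
  simp only [List.mem_cons, List.not_mem_nil, or_false]
  rintro s (rfl | rfl | rfl | rfl | rfl | rfl | rfl)
  · exact relocate_queryFree
  · exact block_queryFree _
  · simp [dedupLoop, outerBody, scanBody, cmpBody, copyBlock, copyBody, seqs, QueryFree,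
      block_queryFree]
  · exact block_queryFree _
  · simp [widthPart, CliqueRed.sizeLoop, seqs, QueryFree, block_queryFree]
  · simp [setupE, seqs, QueryFree, block_queryFree]
  · exact block_queryFree _

/-- The wrapper program is deterministic. [folklore] -/
theorem wrapper_isDeterministic (M : Program) (kM : ℕ) : (wrapper M kM).IsDeterministic :=
  withSubrun_isDeterministic _ _ _ _

/-- The wrapper program is oracle-free. [folklore] -/
theorem wrapper_isOracleFree (M : Program) (kM : ℕ) : (wrapper M kM).IsOracleFree :=
  withSubrun_isOracleFree (pre_queryFree _ _) CliqueRed.post_queryFree _ _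

/-! ### Ghost parameters of a run -/

/-- The data of a run of the wrapper: the clause list, and the word-size constant `kM` and
largest constant `cM` of the sparse-`k`-SAT program. [folklore] -/
structure Params where
  /-- The input clause list. -/
  φ : CNF ℕ
  /-- The word-size constant of the emulated program. -/
  kM : ℕ
  /-- The largest constant of the emulated program. -/
  cM : ℕ

namespace Params

variable (g : Params)

/-- The input words. [folklore] -/
def x : List ℕ := encodeCNFWords g.φ
/-- The input length `Lx`. [folklore] -/
def Lx : ℕ := g.x.length
/-- The base `X` of the relocated input: `x[j]` sits in cell `X + j`. [folklore] -/
def X : ℕ := g.Lx + 101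
/-- The number of clauses. [folklore] -/
def m : ℕ := g.φ.length
/-- The number of variables. [folklore] -/
def n : ℕ := CNF.numVars g.φ
/-- The deduplicated clause list. [folklore] -/
def ψ : CNF ℕ := g.φ.dedup
/-- The emulated input: the encoding of the deduplicated clause list. [folklore] -/
def y : List ℕ := encodeCNFWords g.ψ
/-- Its length. [folklore] -/
def Ly : ℕ := g.y.length
/-- The base of the emulated cells (just above the relocated input). [folklore] -/
def Bv : ℕ := g.X + g.Lx
/-- The number of emitted clauses after `i` input clauses. [folklore] -/
def cnt (i : ℕ) : ℕ := cntD g.φ i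
/-- The quantity whose binary length is the input width of `y`. [folklore] -/
def wv : ℕ := max g.Ly (2 * g.n - 1)
/-- The input width of `y`. [folklore] -/
def σ : ℕ := Nat.size g.wv
/-- The emulated word size. [folklore] -/
def ws : ℕ := g.kM * (g.n + g.σ)
/-- The emulated modulus. [folklore] -/
def Pw : ℕ := 2 ^ g.ws
/-- The value bound of the emulation. [folklore] -/
def V : ℕ := max (g.Pw - 1) g.cM
/-- The base of the stamps. [folklore] -/
def Sv : ℕ := g.Bv + g.V + 1
/-- The emulator environment. [folklore] -/
def env : Env := ⟨g.Bv, g.Sv, 0, g.ws, g.V + 1⟩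

/-- The data while the prefix of length `L` (`L ≥ 2`) of `y` is in place above the header cells:
the relocated input below `Bv`, `y[2 … L-1]` in the emulated cells `3 … L`. [folklore] -/
def preData (L a : ℕ) : ℕ :=
  if a < g.Bv then relocated g.x a
  else if g.Bv + 3 ≤ a ∧ a < g.Bv + 1 + L then g.y.getD (a - g.Bv - 1) 0 else 0

/-- The final data: the relocated input and the emulated input `|y|, y`. [folklore] -/
def finData (a : ℕ) : ℕ :=
  if a < g.Bv then relocated g.x a
  else if a = g.Bv then g.Ly
  else if a ≤ g.Bv + g.Ly then g.y.getD (a - g.Bv - 1) 0 else 0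

/-- **The final memory of the build**: registers `10–13` hold `Bv, Sv, 0, Pw`, every other
register is `0`, and the data is `finData`. [folklore] -/
def finMem (a : ℕ) : ℕ :=
  if a < 100 then (if a = 10 then g.Bv else if a = 11 then g.Sv else if a = 13 then g.Pw else 0)
  else g.finData a

/-- **Word-size requirements** of a run at word size `W`. [folklore] -/
structure Fits (W : ℕ) : Prop where
  top : g.Sv + g.V + 1 ≤ 2 ^ W
  ws_lt : g.ws < W
  width : inputWidth g.x ≤ W
  lx3 : 3 * g.Lx + 103 ≤ 2 ^ W

/-! ### Basic facts -/

/-- `σ` is the input width of the emulated input. [folklore] -/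
theorem sigma_eq : g.σ = inputWidth g.y := by
  unfold σ wv Ly y n
  rw [inputWidth_encodeCNFWords, ψ, numVars_dedup]

/-- The emulated word size is the one the sparse-`k`-SAT program is run at. [folklore] -/
theorem ws_eq : g.ws = g.kM * (CNF.numVars g.ψ + inputWidth g.y) := by
  unfold ws; rw [sigma_eq, ψ, numVars_dedup]; rfl

/-- `2 ≤ Lx`. [folklore] -/
theorem two_le_Lx : 2 ≤ g.Lx := by
  unfold Lx x; rw [length_encodeCNFWords_eq]; omega

/-- `m + 2 ≤ Lx`. [folklore] -/
theorem m_add_two_le_Lx : g.m + 2 ≤ g.Lx := by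
  unfold Lx x m; rw [length_encodeCNFWords_eq, CNF.numClauses]; omega

/-- `|ψ| + 2 ≤ Ly`. [folklore] -/
theorem length_add_two_le_Ly : g.ψ.length + 2 ≤ g.Ly := by
  unfold Ly y; rw [length_encodeCNFWords_eq, CNF.numClauses]; omega

/-- `Ly ≤ Lx`. [folklore] -/
theorem Ly_le_Lx : g.Ly ≤ g.Lx := length_encodeCNFWords_dedup_le g.φ

/-- `wv < 2 ^ σ`. [folklore] -/
theorem wv_lt : g.wv < 2 ^ g.σ := Nat.lt_size_self _

/-- Under `Fits`, the input words fit. [folklore] -/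
theorem Fits.input {g : Params} {W : ℕ} (h : g.Fits W) : ∀ v ∈ g.x, v < 2 ^ W := fun v hv =>
  lt_of_lt_of_le (lt_two_pow_inputWidth_of_mem g.x v hv) (Nat.pow_le_pow_right Nat.two_pos h.width)

/-- The standard linear facts about the ghost parameters under `Fits` and `kM ≥ 1`. [folklore] -/
theorem facts {W : ℕ} (hF : g.Fits W) (hk : 1 ≤ g.kM) :
    100 < g.X ∧ g.X = g.Lx + 101 ∧ g.Bv = g.X + g.Lx ∧ g.Sv = g.Bv + g.V + 1 ∧
    g.Sv + g.V + 1 ≤ 2 ^ W ∧ g.Pw ≤ g.V + 1 ∧ g.cM ≤ g.V ∧ 2 ≤ g.Lx ∧ g.m + 2 ≤ g.Lx ∧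
    g.Ly ≤ g.Lx ∧ g.ψ.length + 2 ≤ g.Ly ∧ g.n + g.σ ≤ g.ws ∧ g.ws < W ∧ W < 2 ^ W ∧
    g.wv < 2 ^ W ∧ 1 ≤ g.Pw ∧ g.Pw < 2 ^ W ∧ 3 * g.Lx + 103 ≤ 2 ^ W ∧ 2 * g.n ≤ g.wv + 1 ∧
    g.Ly ≤ g.wv ∧ g.wv < 2 ^ g.σ ∧ 2 ^ g.σ < 2 ^ W ∧ 2 ^ g.σ ≤ g.Pw := by
  have hws : g.n + g.σ ≤ g.ws := by
    unfold ws; exact Nat.le_mul_of_pos_left _ hk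
  have hσW : 2 ^ g.σ < 2 ^ W := Nat.pow_lt_pow_right (by norm_num) (by have := hF.ws_lt; omega)
  have hσPw : 2 ^ g.σ ≤ g.Pw := Nat.pow_le_pow_right Nat.two_pos (by omega)
  have hwv : g.wv < 2 ^ W := lt_trans g.wv_lt hσW
  refine ⟨by unfold X; omega, rfl, rfl, rfl, hF.top, ?_, le_max_right _ _, g.two_le_Lx,
    g.m_add_two_le_Lx, g.Ly_le_Lx, g.length_add_two_le_Ly, hws, hF.ws_lt, Nat.lt_two_pow_self,
    hwv, Nat.one_le_two_pow, Nat.pow_lt_pow_right (by norm_num) hF.ws_lt, hF.lx3, ?_,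
    le_max_left _ _, g.wv_lt, hσW, hσPw⟩
  · unfold V; have := Nat.one_le_two_pow (n := g.ws); unfold Pw; omega
  · unfold wv; omega

/-! ### Reading the relocated input and the closed-form data -/

/-- Cell `0` after relocation holds `X`. [folklore] -/
@[simp] theorem relocated_zero' : relocated g.x 0 = g.X := by
  rw [relocated_zero]; rfl

/-- The relocated input: `x[j]` sits in cell `X + j` (and `0` past the input). [folklore] -/
theorem relocated_X_add (j : ℕ) : relocated g.x (g.X + j) = g.x.getD j 0 := by
  by_cases hj : j < g.Lx
  · have := relocated_base_add g.x (i := j + 1) (by omega) (by unfold Lx at hj; omega)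
    rw [show g.x.length + 100 + (j + 1) = g.X + j by unfold X Lx; omega] at this
    rw [this]; rfl
  · rw [relocated_of_lt g.x (by unfold X Lx at *; omega),
      List.getD_eq_default _ _ (by unfold Lx at hj; omega)]

/-- Everything from `Bv` on is `0` after relocation. [folklore] -/
theorem relocated_of_Bv_le {a : ℕ} (ha : g.Bv ≤ a) : relocated g.x a = 0 :=
  relocated_of_lt g.x (by unfold Bv X Lx at ha; omega)

/-- Word `0` of the input is `n`. [folklore] -/
theorem x_getD_zero : g.x.getD 0 0 = g.n := by
  unfold x n; rw [List.getD_eq_getElem?_getD, encodeCNFWords_getElem?_zero]; rfl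

/-- Word `1` of the input is `m`. [folklore] -/
theorem x_getD_one : g.x.getD 1 0 = g.m := by
  unfold x m; rw [List.getD_eq_getElem?_getD, encodeCNFWords_getElem?_one]; rfl

/-- The length word of clause `i` in the input. [folklore] -/
theorem x_getD_clauseStart {i : ℕ} (hi : i < g.m) :
    g.x.getD (clauseStart g.φ i) 0 = (g.φ[i]'hi).length := by
  unfold x; rw [List.getD_eq_getElem?_getD, encodeCNFWords_getElem?_clauseStart g.φ hi]; rfl

/-- Clause blocks lie inside the input. [folklore] -/
theorem clauseStart_le {i : ℕ} (hi : i < g.m) : clauseStart g.φ i + 1 + (g.φ[i]'hi).length ≤ g.Lx :=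
  clauseStart_add_length_le g.φ hi

/-- `clauseStart φ m = Lx`. [folklore] -/
theorem clauseStart_m : clauseStart g.φ g.m = g.Lx := by
  unfold Lx x m; rw [length_encodeCNFWords]

/-- The length word of clause `j` of the output. [folklore] -/
theorem y_getD_clauseStart {j : ℕ} (hj : j < g.ψ.length) :
    g.y.getD (clauseStart g.ψ j) 0 = (g.ψ[j]'hj).length := by
  unfold y; rw [List.getD_eq_getElem?_getD, encodeCNFWords_getElem?_clauseStart g.ψ hj]; rfl

/-- The literal words of clause `j` of the output. [folklore] -/
theorem y_getD_lit {j : ℕ} (hj : j < g.ψ.length) {t : ℕ} (ht : t < (g.ψ[j]'hj).length) :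
    g.y.getD (clauseStart g.ψ j + 1 + t) 0 = litCode ((g.ψ[j]'hj)[t]'ht) := by
  unfold y; rw [List.getD_eq_getElem?_getD, encodeCNFWords_getElem?_clauseStart_succ g.ψ hj ht]; rfl

/-- The literal words of clause `i` of the input. [folklore] -/
theorem x_getD_lit {i : ℕ} (hi : i < g.m) {t : ℕ} (ht : t < (g.φ[i]'hi).length) :
    g.x.getD (clauseStart g.φ i + 1 + t) 0 = litCode ((g.φ[i]'hi)[t]'ht) := by
  unfold x; rw [List.getD_eq_getElem?_getD, encodeCNFWords_getElem?_clauseStart_succ g.φ hi ht]; rfl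

/-- Output blocks lie inside the output. [folklore] -/
theorem clauseStart_ψ_le {j : ℕ} (hj : j < g.ψ.length) :
    clauseStart g.ψ j + 1 + (g.ψ[j]'hj).length ≤ g.Ly :=
  clauseStart_add_length_le g.ψ hj

/-- `clauseStart ψ |ψ| = Ly`. [folklore] -/
theorem clauseStart_ψ_length : clauseStart g.ψ g.ψ.length = g.Ly := by
  unfold Ly y; rw [length_encodeCNFWords]

/-- Below `Bv` the staged data is the relocated input. [folklore] -/
theorem preData_of_lt {L a : ℕ} (ha : a < g.Bv) : g.preData L a = relocated g.x a := by
  unfold preData; rw [if_pos ha]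

/-- The staged data at an input cell. [folklore] -/
theorem preData_X_add (L : ℕ) {j : ℕ} (hj : j < g.Lx) : g.preData L (g.X + j) = g.x.getD j 0 := by
  rw [g.preData_of_lt (by unfold Bv; omega), relocated_X_add]

/-- The staged data at an emitted output cell. [folklore] -/
theorem preData_out {L a : ℕ} (h3 : g.Bv + 3 ≤ a) (hL : a < g.Bv + 1 + L) :
    g.preData L a = g.y.getD (a - g.Bv - 1) 0 := by
  unfold preData; rw [if_neg (by omega), if_pos ⟨h3, hL⟩]

/-- The staged data above the emitted part. [folklore] -/
theorem preData_above {L a : ℕ} (hL : g.Bv + 1 + L ≤ a) (h3 : g.Bv ≤ a) : g.preData L a = 0 := by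
  unfold preData; rw [if_neg (by omega), if_neg (by omega)]

/-- Stage `2` is the relocated memory (above the registers). [folklore] -/
theorem preData_two (a : ℕ) : g.preData 2 a = relocated g.x a := by
  unfold preData
  by_cases ha : a < g.Bv
  · rw [if_pos ha]
  · rw [if_neg ha, if_neg (by omega), g.relocated_of_Bv_le (not_lt.1 ha)]

/-- **One output word written**: writing `y[L]` at `Bv + 1 + L` (`L ≥ 2`) turns stage `L` into
stage `L + 1`. [folklore] -/
theorem preData_succ {L : ℕ} (hL : 2 ≤ L) {m : ℕ → ℕ} (hm : ∀ a, 100 ≤ a → m a = g.preData L a)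
    (a : ℕ) (ha : 100 ≤ a) :
    Function.update m (g.Bv + 1 + L) (g.y.getD L 0) a = g.preData (L + 1) a := by
  by_cases h1 : a = g.Bv + 1 + L
  · subst h1
    rw [Function.update_self, g.preData_out (by omega) (by omega)]
    congr 1; omega
  · rw [Function.update_of_ne h1, hm a ha]
    unfold preData
    by_cases h2 : a < g.Bv
    · rw [if_pos h2, if_pos h2]
    · rw [if_neg h2, if_neg h2]
      by_cases h3 : g.Bv + 3 ≤ a ∧ a < g.Bv + 1 + L
      · rw [if_pos h3, if_pos ⟨h3.1, by omega⟩]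
      · rw [if_neg h3, if_neg (by omega)]


/-! ### Clauses by index, the comparison accumulator, the scan result -/

/-- Clause `i` of the input as a total function. [folklore] -/
def cl (i : ℕ) : Clause ℕ := g.φ.getD i []

/-- `cl i` is the `i`-th clause. [folklore] -/
theorem cl_eq {i : ℕ} (hi : i < g.m) : g.cl i = g.φ[i]'hi := List.getD_eq_getElem _ _ hi

/-- The comparison accumulator after `t` words of clause `i` against the block at clause `j`:
equal lengths and equal first `t` words (the `j`-side read through the staged data). [folklore] -/
def cmpAcc (L i j t : ℕ) : Bool :=
  decide ((g.cl i).length = (g.cl j).length) &&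
    (List.range t).all fun t' => decide (g.x.getD (clauseStart g.φ i + 1 + t') 0 =
      g.preData L (g.X + (clauseStart g.φ j + 1 + t')))

/-- No word compared. [folklore] -/
theorem cmpAcc_zero (L i j : ℕ) :
    g.cmpAcc L i j 0 = decide ((g.cl i).length = (g.cl j).length) := by
  simp [cmpAcc]

/-- One more word. [folklore] -/
theorem cmpAcc_succ (L i j t : ℕ) : g.cmpAcc L i j (t + 1) = (g.cmpAcc L i j t &&
    decide (g.x.getD (clauseStart g.φ i + 1 + t) 0 =
      g.preData L (g.X + (clauseStart g.φ j + 1 + t)))) := by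
  simp [cmpAcc, List.range_succ, List.all_append, Bool.and_assoc]

/-- **The finished comparison decides equality of the clauses.** [folklore] -/
theorem cmpAcc_length (L : ℕ) {i j : ℕ} (hi : i < g.m) (hj : j < g.m) :
    g.cmpAcc L i j (g.cl i).length = decide (g.φ[i]'hi = g.φ[j]'hj) := by
  have hci := g.cl_eq hi
  have hcj := g.cl_eq hj
  have hcsj := g.clauseStart_le hj
  unfold cmpAcc
  rw [hci, hcj]
  by_cases hlen : (g.φ[i]'hi).length = (g.φ[j]'hj).length
  · rw [decide_eq_true hlen, Bool.true_and]
    have key : ((List.range (g.φ[i]'hi).length).all fun t' =>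
        decide (g.x.getD (clauseStart g.φ i + 1 + t') 0 =
          g.preData L (g.X + (clauseStart g.φ j + 1 + t')))) =
        decide (∀ t, t < (g.φ[i]'hi).length → g.x.getD (clauseStart g.φ i + 1 + t) 0 =
          g.x.getD (clauseStart g.φ j + 1 + t) 0) := by
      apply Bool.eq_iff_iff.2
      simp only [List.all_eq_true, List.mem_range, decide_eq_true_eq]
      refine forall₂_congr fun t ht => ?_
      rw [g.preData_X_add L (by omega)]
    rw [key]
    have hw := clause_eq_iff_words g.φ hi hj
    apply Bool.decide_congr
    constructor
    · intro h; exact hw.2 ⟨hlen, h⟩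
    · intro h; exact (hw.1 h).2
  · rw [decide_eq_false hlen, Bool.false_and]
    symm; rw [decide_eq_false_iff_not]
    intro h; exact hlen (by rw [h])

/-- The scan result after `u` later clauses: does clause `i` occur among them? [folklore] -/
def found (i u : ℕ) : Bool := decide (g.cl i ∈ (g.φ.drop (i + 1)).take u)

/-- No clause scanned. [folklore] -/
theorem found_zero (i : ℕ) : g.found i 0 = false := by simp [found]

/-- One more clause scanned. [folklore] -/
theorem found_succ {i u : ℕ} (hi : i < g.m) (hu : i + 1 + u < g.m) :
    g.found i (u + 1) = (g.found i u || decide (g.φ[i]'hi = g.φ[i + 1 + u]'hu)) := by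
  apply Bool.eq_iff_iff.2
  simp only [found, Bool.or_eq_true, decide_eq_true_eq, g.cl_eq hi]
  rw [List.take_add_one, List.getElem?_drop, List.getElem?_eq_getElem hu]
  simp [List.mem_append]

/-- All later clauses scanned. [folklore] -/
theorem found_all {i : ℕ} (hi : i < g.m) :
    g.found i (g.m - (i + 1)) = decide (g.φ[i]'hi ∈ g.φ.drop (i + 1)) := by
  unfold found
  rw [g.cl_eq hi, List.take_of_length_le (by simp [m])]


end Params

/-- **The arithmetic of the scan's OR step**: `found := ¬([eq = 0] ∧ [found = 0])`. [folklore] -/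
theorem or_step (c d : Bool) :
    (if ((if c.toNat = 0 then 1 else 0) &&& (if d.toNat = 0 then 1 else 0)) < 1 then 1 else 0) =
      (d || c).toNat := by
  cases c <;> cases d <;> rfl

namespace Params

variable (g : Params) {W : ℕ} {O : List ℕ → List ℕ}

/-! ### Register conventions of the deduplication loop -/

/-- The registers of the outer loop after `i` input clauses. [folklore] -/
structure Base (i : ℕ) (m : ℕ → ℕ) : Prop where
  r0 : m 0 = g.X
  r2 : m 2 = g.m - i
  r3 : m 3 = g.X + clauseStart g.φ i
  r4 : m 4 = g.Bv + 1 + clauseStart g.ψ (g.cnt i)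
  r5 : m 5 = g.cnt i
  r10 : m 10 = g.Bv

/-- The invariant of the outer loop after `i` input clauses. [folklore] -/
structure OuterInv (i : ℕ) (m : ℕ → ℕ) : Prop where
  base : g.Base i m
  data : ∀ a, 100 ≤ a → m a = g.preData (clauseStart g.ψ (g.cnt i)) a

/-- The invariant of the scan of clause `i` after `u` later clauses. [folklore] -/
structure ScanInv (i u : ℕ) (m : ℕ → ℕ) : Prop where
  base : g.Base i m
  r6 : m 6 = (g.cl i).length
  r7 : m 7 = g.X + clauseStart g.φ (i + 1 + u)
  r8 : m 8 = g.m - (i + 1) - u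
  r9 : m 9 = (g.found i u).toNat
  data : ∀ a, 100 ≤ a → m a = g.preData (clauseStart g.ψ (g.cnt i)) a

/-- The invariant of the comparison of clause `i` with clause `i + 1 + u` after `t` words.
[folklore] -/
structure CmpInv (i u t : ℕ) (m : ℕ → ℕ) : Prop where
  base : g.Base i m
  r6 : m 6 = (g.cl i).length
  r7 : m 7 = g.X + clauseStart g.φ (i + 1 + u)
  r8 : m 8 = g.m - (i + 1) - u
  r9 : m 9 = (g.found i u).toNat
  r20 : m 20 = (g.cl (i + 1 + u)).length
  r21 : m 21 = (g.cmpAcc (clauseStart g.ψ (g.cnt i)) i (i + 1 + u) t).toNat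
  r23 : m 23 = t
  r24 : m 24 = (g.cl i).length - t
  data : ∀ a, 100 ≤ a → m a = g.preData (clauseStart g.ψ (g.cnt i)) a

/-- Clause lengths and starts are bounded by `Lx`. [folklore] -/
theorem cl_bounds {i : ℕ} (hi : i < g.m) :
    clauseStart g.φ i + 1 + (g.cl i).length ≤ g.Lx ∧ (g.cl i).length ≤ g.Lx ∧
      clauseStart g.φ (i + 1) = clauseStart g.φ i + 1 + (g.cl i).length := by
  have h1 := g.clauseStart_le hi
  rw [← g.cl_eq hi] at h1
  refine ⟨h1, by omega, ?_⟩
  rw [clauseStart_succ g.φ hi, g.cl_eq hi]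

/-- Every clause start is at most `Lx`. [folklore] -/
theorem clauseStart_le_Lx (i : ℕ) : clauseStart g.φ i ≤ g.Lx := by
  rcases le_total i g.m with h | h
  · rw [← g.clauseStart_m]; exact clauseStart_mono g.φ h
  · unfold clauseStart Lx x m at *
    rw [List.take_of_length_le h, length_encodeCNFWords, clauseStart, List.take_length]

/-! ### The comparison loop -/

/-- **The comparison loop** of clause `i` against clause `i + 1 + u`. [folklore] -/
theorem cmp_loop (hF : g.Fits W) (hk : 1 ≤ g.kM) {i u : ℕ} (hu : i + 1 + u < g.m)
    {m : ℕ → ℕ} (h0 : g.CmpInv i u 0 m) :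
    Achieves W O (whilenz (r 24) cmpBody) m (g.CmpInv i u (g.cl i).length) (g.Lx * 12 + 1) := by
  obtain ⟨hX, hXLx, hBv, hSv, htop, hPwV, hcMV, h2Lx, hmLx, hLyLx, hψLy, hnσ, hwsW, hWW, hwvW,
    hPw1, hPwW, hLx3, h2n, hLywv, hwvσ, hσW, hσPw⟩ := g.facts hF hk
  have hi : i < g.m := by omega
  obtain ⟨hcsi, hleni, -⟩ := g.cl_bounds hi
  have hcsj := g.clauseStart_le_Lx (i + 1 + u)
  set L := clauseStart g.ψ (g.cnt i) with hL
  refine Achieves.whilenz (g.cl i).length 10 (fun t => g.CmpInv i u t) (fun t ht m' hI => ⟨?_, ?_⟩)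
    (fun m' hI => ?_) h0 (fun _ h => h) (by nlinarith)
  · simp only [Operand.read, hI.r24]; omega
  · obtain ⟨⟨r0, r2, r3, r4, r5, r10⟩, r6, r7, r8, r9, r20, r21, r23, r24, hD⟩ := hI
    have hread1 : m' (g.X + clauseStart g.φ i + t + 1) = g.x.getD (clauseStart g.φ i + 1 + t) 0 := by
      rw [hD _ (by omega), show g.X + clauseStart g.φ i + t + 1 = g.X + (clauseStart g.φ i + 1 + t)
        by omega, g.preData_X_add _ (by omega)]
    have hread2 : m' (g.X + clauseStart g.φ (i + 1 + u) + t + 1) =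
        g.preData L (g.X + (clauseStart g.φ (i + 1 + u) + 1 + t)) := by
      rw [hD _ (by omega)]; congr 1; omega
    refine CliqueRed.achieves_block_of_eq (fun m'' hm'' => ?_) le_rfl
    simp (disch := first | omega | decide) only [execOps_cons, execOps_nil, execOp, Operand.write,
      Operand.read, merge_apply_of_lt, merge_apply_of_le, update_merge_of_lt, Function.update_self,
      Function.update_of_ne, BinOp.eval_add_of_lt, BinOp.eval_sub_of_le, BinOp.eval_band,
      BinOp.eval_eq, Nat.and_self, r3, r7, r21, r23, r24, hread1, hread2] at hm''
    subst hm''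
    refine ⟨⟨?_, ?_, ?_, ?_, ?_, ?_⟩, ?_, ?_, ?_, ?_, ?_, ?r21, ?_, ?_, fun a ha => ?data⟩
    case data => rw [merge_apply_of_le ha]; exact hD a ha
    case r21 =>
      simp (disch := first | omega | decide) only [merge_apply_of_lt, Function.update_self,
        Function.update_of_ne]
      rw [cmpAcc_succ, CliqueRed.ite_eq_toNat_decide, CliqueRed.toNat_and_toNat]
    all_goals (try simp (disch := first | omega | decide) only [merge_apply_of_lt,
      Function.update_self, Function.update_of_ne])
    all_goals first | assumption | omega
  · simp only [Operand.read, hI.r24]; omega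

/-! ### The scan loop -/

/-- **One later clause.** [folklore] -/
theorem scanBody_spec (hF : g.Fits W) (hk : 1 ≤ g.kM) {i u : ℕ} (hu : i + 1 + u < g.m)
    {m : ℕ → ℕ} (h0 : g.ScanInv i u m) : Achieves W O scanBody m (g.ScanInv i (u + 1)) (g.Lx * 12 + 12) := by
  obtain ⟨hX, hXLx, hBv, hSv, htop, hPwV, hcMV, h2Lx, hmLx, hLyLx, hψLy, hnσ, hwsW, hWW, hwvW,
    hPw1, hPwW, hLx3, h2n, hLywv, hwvσ, hσW, hσPw⟩ := g.facts hF hk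
  have hi : i < g.m := by omega
  obtain ⟨hcsi, hleni, -⟩ := g.cl_bounds hi
  obtain ⟨hcsj, hlenj, hcsj'⟩ := g.cl_bounds hu
  set L := clauseStart g.ψ (g.cnt i) with hL
  obtain ⟨⟨r0, r2, r3, r4, r5, r10⟩, r6, r7, r8, r9, hD⟩ := h0
  have hreadj : m (g.X + clauseStart g.φ (i + 1 + u)) = (g.cl (i + 1 + u)).length := by
    rw [hD _ (by omega), g.preData_X_add _ (by omega), g.x_getD_clauseStart hu, g.cl_eq hu]
  unfold scanBody
  refine Achieves.mono (T := 4 + ((g.Lx * 12 + 1) + (7 + 0))) ?_ (fun _ h => h) (by omega)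
  -- block 1
  refine Achieves.seqs_cons (R := g.CmpInv i u 0) (T₁ := 4) ?_ fun m₁ h₁ => ?_
  · refine CliqueRed.achieves_block_of_eq (fun m' hm' => ?_) le_rfl
    simp (disch := first | omega | decide) only [execOps_cons, execOps_nil, execOp, Operand.write,
      Operand.read, merge_apply_of_lt, merge_apply_of_le, update_merge_of_lt, Function.update_self,
      Function.update_of_ne, BinOp.eval_band, BinOp.eval_eq, Nat.and_self, r6, r7, hreadj] at hm'
    subst hm'
    refine ⟨⟨?_, ?_, ?_, ?_, ?_, ?_⟩, ?_, ?_, ?_, ?_, ?_, ?r21, ?_, ?_, fun a ha => ?data⟩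
    case data => rw [merge_apply_of_le ha]; exact hD a ha
    case r21 =>
      simp (disch := first | omega | decide) only [merge_apply_of_lt, Function.update_self,
        Function.update_of_ne]
      rw [cmpAcc_zero, CliqueRed.ite_eq_toNat_decide]
    all_goals (try simp (disch := first | omega | decide) only [merge_apply_of_lt,
      Function.update_self, Function.update_of_ne])
    all_goals first | assumption | omega
  -- the comparison loop
  refine Achieves.seqs_cons (R := g.CmpInv i u (g.cl i).length) (T₁ := g.Lx * 12 + 1)
    (g.cmp_loop hF hk hu h₁) fun m₂ h₂ => ?_
  obtain ⟨⟨s0, s2, s3, s4, s5, s10⟩, s6, s7, s8, s9, s20, s21, s23, s24, sD⟩ := h₂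
  rw [g.cmpAcc_length _ hi hu] at s21
  have e7 : clauseStart g.φ (i + 1 + (u + 1)) =
      clauseStart g.φ (i + 1 + u) + 1 + (g.cl (i + 1 + u)).length := hcsj'
  -- block 3
  refine Achieves.seqs_cons (T₁ := 7) (T₂ := 0) ?_ (fun _ h => Achieves.seqs_nil h)
  refine CliqueRed.achieves_block_of_eq (fun m' hm' => ?_) le_rfl
  simp (disch := first | omega | decide) only [execOps_cons, execOps_nil, execOp, Operand.write,
    Operand.read, merge_apply_of_lt, update_merge_of_lt, Function.update_self,
    Function.update_of_ne, BinOp.eval_add_of_lt, BinOp.eval_sub_of_le, BinOp.eval_band,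
    BinOp.eval_eq, BinOp.eval_lt, s7, s8, s9, s20, s21] at hm'
  subst hm'
  refine ⟨⟨?_, ?_, ?_, ?_, ?_, ?_⟩, ?_, ?_, ?_, ?r9, fun a ha => ?data⟩
  case data => rw [merge_apply_of_le ha]; exact sD a ha
  case r9 =>
    simp (disch := first | omega | decide) only [merge_apply_of_lt, Function.update_self,
      Function.update_of_ne]
    rw [or_step, g.found_succ hi hu]
  all_goals (try simp (disch := first | omega | decide) only [merge_apply_of_lt,
    Function.update_self, Function.update_of_ne])
  all_goals first | assumption | omega

/-- **The scan loop** of clause `i` over all later clauses. [folklore] -/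
theorem scan_loop (hF : g.Fits W) (hk : 1 ≤ g.kM) {i : ℕ} (hi : i < g.m)
    {m : ℕ → ℕ} (h0 : g.ScanInv i 0 m) :
    Achieves W O (whilenz (r 8) scanBody) m (g.ScanInv i (g.m - (i + 1)))
      ((g.m - (i + 1)) * (g.Lx * 12 + 14) + 1) := by
  refine Achieves.whilenz (g.m - (i + 1)) (g.Lx * 12 + 12) (fun u => g.ScanInv i u)
    (fun u hu m' hI => ⟨?_, g.scanBody_spec hF hk (by omega) hI⟩) (fun m' hI => ?_) h0
    (fun _ h => h) le_rfl
  · simp only [Operand.read, hI.r8]; omega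
  · simp only [Operand.read, hI.r8]; omega


/-! ### The copy -/

/-- The invariant of the copy of clause `i` after `t` words. [folklore] -/
structure CopyInv (i t : ℕ) (m : ℕ → ℕ) : Prop where
  base : g.Base i m
  r6 : m 6 = (g.cl i).length
  r23 : m 23 = t
  r24 : m 24 = (g.cl i).length - t
  data : ∀ a, 100 ≤ a → m a = g.preData (clauseStart g.ψ (g.cnt i) + 1 + t) a

/-- The registers after clause `i` has been scanned and emitted or skipped. [folklore] -/
structure AfterInv (i : ℕ) (m : ℕ → ℕ) : Prop where
  r0 : m 0 = g.X
  r2 : m 2 = g.m - i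
  r3 : m 3 = g.X + clauseStart g.φ i
  r4 : m 4 = g.Bv + 1 + clauseStart g.ψ (g.cnt (i + 1))
  r5 : m 5 = g.cnt (i + 1)
  r10 : m 10 = g.Bv
  r6 : m 6 = (g.cl i).length
  data : ∀ a, 100 ≤ a → m a = g.preData (clauseStart g.ψ (g.cnt (i + 1))) a

/-- **A surviving clause is the next output clause**: its block in `y`. [folklore] -/
theorem survivor {i : ℕ} (hi : i < g.m) (hnot : g.φ[i]'hi ∉ g.φ.drop (i + 1)) :
    g.cnt (i + 1) = g.cnt i + 1 ∧ g.cnt i < g.ψ.length ∧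
    clauseStart g.ψ (g.cnt i + 1) = clauseStart g.ψ (g.cnt i) + 1 + (g.cl i).length ∧
    g.y.getD (clauseStart g.ψ (g.cnt i)) 0 = (g.cl i).length ∧
    ∀ t, t < (g.cl i).length →
      g.x.getD (clauseStart g.φ i + 1 + t) 0 = g.y.getD (clauseStart g.ψ (g.cnt i) + 1 + t) 0 := by
  obtain ⟨h1, h2, h3⟩ := cntD_succ_of_not_mem g.φ hi hnot
  have hc : g.cnt i < g.ψ.length := h2
  have hψc : g.ψ[g.cnt i]'hc = g.φ[i]'hi := by
    have := (List.getElem?_eq_getElem hc).symm.trans h3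
    exact Option.some.inj this
  have hcl := g.cl_eq hi
  refine ⟨h1, hc, ?_, ?_, fun t ht => ?_⟩
  · rw [clauseStart_succ g.ψ hc, hψc, hcl]
  · rw [g.y_getD_clauseStart hc, hψc, hcl]
  · have ht' : t < (g.φ[i]'hi).length := by rwa [hcl] at ht
    rw [g.x_getD_lit hi ht', g.y_getD_lit hc (by rw [hψc]; exact ht')]
    congr 1
    simp [hψc]

/-- **The copy loop.** [folklore] -/
theorem copy_loop (hF : g.Fits W) (hk : 1 ≤ g.kM) {i : ℕ} (hi : i < g.m)
    (hnot : g.φ[i]'hi ∉ g.φ.drop (i + 1)) {m : ℕ → ℕ} (h0 : g.CopyInv i 0 m) :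
    Achieves W O (whilenz (r 24) copyBody) m (g.CopyInv i (g.cl i).length) (g.Lx * 10 + 1) := by
  obtain ⟨hX, hXLx, hBv, hSv, htop, hPwV, hcMV, h2Lx, hmLx, hLyLx, hψLy, hnσ, hwsW, hWW, hwvW,
    hPw1, hPwW, hLx3, h2n, hLywv, hwvσ, hσW, hσPw⟩ := g.facts hF hk
  obtain ⟨hcsi, hleni, -⟩ := g.cl_bounds hi
  obtain ⟨hc1, hc, hcs', hylen, hyw⟩ := g.survivor hi hnot
  have hcs1 : clauseStart g.ψ (g.cnt i + 1) ≤ g.Ly := by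
    rw [← g.clauseStart_ψ_length]; exact clauseStart_mono g.ψ hc
  have h2c : 2 ≤ clauseStart g.ψ (g.cnt i) := clauseStart_mono g.ψ (Nat.zero_le _)
  refine Achieves.whilenz (g.cl i).length 8 (fun t => g.CopyInv i t) (fun t ht m' hI => ⟨?_, ?_⟩)
    (fun m' hI => ?_) h0 (fun _ h => h) (by nlinarith)
  · simp only [Operand.read, hI.r24]; omega
  · obtain ⟨⟨r0, r2, r3, r4, r5, r10⟩, r6, r23, r24, hD⟩ := hI
    have hread1 : m' (g.X + clauseStart g.φ i + t + 1) = g.x.getD (clauseStart g.φ i + 1 + t) 0 := by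
      rw [hD _ (by omega), show g.X + clauseStart g.φ i + t + 1 = g.X + (clauseStart g.φ i + 1 + t)
        by omega, g.preData_X_add _ (by omega)]
    refine CliqueRed.achieves_block_of_eq (fun m'' hm'' => ?_) le_rfl
    simp (disch := first | omega | decide) only [execOps_cons, execOps_nil, execOp, Operand.write,
      Operand.read, merge_apply_of_lt, merge_apply_of_le, update_merge_of_lt, update_merge_of_le,
      Function.update_self, Function.update_of_ne, BinOp.eval_add_of_lt, BinOp.eval_sub_of_le,
      BinOp.eval_band, Nat.and_self, r3, r4, r23, r24, hread1] at hm''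
    subst hm''
    refine ⟨⟨?_, ?_, ?_, ?_, ?_, ?_⟩, ?_, ?_, ?_, fun a ha => ?data⟩
    case data =>
      rw [merge_apply_of_le ha, hyw t ht,
        show g.Bv + 1 + clauseStart g.ψ (g.cnt i) + t + 1 =
          g.Bv + 1 + (clauseStart g.ψ (g.cnt i) + 1 + t) by omega,
        show clauseStart g.ψ (g.cnt i) + 1 + (t + 1) = clauseStart g.ψ (g.cnt i) + 1 + t + 1 by omega]
      exact g.preData_succ (by omega) hD a ha
    all_goals (try simp (disch := first | omega | decide) only [merge_apply_of_lt,
      Function.update_self, Function.update_of_ne])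
    all_goals first | assumption | omega
  · simp only [Operand.read, hI.r24]; omega

/-- **Emitting clause `i`.** [folklore] -/
theorem copyBlock_spec (hF : g.Fits W) (hk : 1 ≤ g.kM) {i : ℕ} (hi : i < g.m)
    (hnot : g.φ[i]'hi ∉ g.φ.drop (i + 1)) {m : ℕ → ℕ} (hB : g.Base i m)
    (h6 : m 6 = (g.cl i).length)
    (hD : ∀ a, 100 ≤ a → m a = g.preData (clauseStart g.ψ (g.cnt i)) a) :
    Achieves W O copyBlock m (g.AfterInv i) (g.Lx * 10 + 7) := by
  obtain ⟨hX, hXLx, hBv, hSv, htop, hPwV, hcMV, h2Lx, hmLx, hLyLx, hψLy, hnσ, hwsW, hWW, hwvW,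
    hPw1, hPwW, hLx3, h2n, hLywv, hwvσ, hσW, hσPw⟩ := g.facts hF hk
  obtain ⟨hcsi, hleni, -⟩ := g.cl_bounds hi
  obtain ⟨hc1, hc, hcs', hylen, hyw⟩ := g.survivor hi hnot
  have hcs1 : clauseStart g.ψ (g.cnt i + 1) ≤ g.Ly := by
    rw [← g.clauseStart_ψ_length]; exact clauseStart_mono g.ψ hc
  have h2c : 2 ≤ clauseStart g.ψ (g.cnt i) := clauseStart_mono g.ψ (Nat.zero_le _)
  obtain ⟨r0, r2, r3, r4, r5, r10⟩ := hB
  unfold copyBlock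
  refine Achieves.mono (T := 3 + ((g.Lx * 10 + 1) + (3 + 0))) ?_ (fun _ h => h) (by omega)
  -- block 1
  refine Achieves.seqs_cons (R := g.CopyInv i 0) (T₁ := 3) ?_ fun m₁ h₁ => ?_
  · refine CliqueRed.achieves_block_of_eq (fun m' hm' => ?_) le_rfl
    simp (disch := first | omega | decide) only [execOps_cons, execOps_nil, execOp, Operand.write,
      Operand.read, merge_apply_of_lt, update_merge_of_lt, update_merge_of_le,
      Function.update_of_ne, BinOp.eval_band, Nat.and_self, r4, h6] at hm'
    subst hm'
    refine ⟨⟨?_, ?_, ?_, ?_, ?_, ?_⟩, ?_, ?_, ?_, fun a ha => ?data⟩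
    case data =>
      rw [merge_apply_of_le ha, ← hylen, Nat.add_zero]
      exact g.preData_succ h2c hD a ha
    all_goals (try simp (disch := first | omega | decide) only [merge_apply_of_lt,
      Function.update_self, Function.update_of_ne])
    all_goals first | assumption | omega
  -- the copy loop
  refine Achieves.seqs_cons (R := g.CopyInv i (g.cl i).length) (T₁ := g.Lx * 10 + 1)
    (g.copy_loop hF hk hi hnot h₁) fun m₂ h₂ => ?_
  obtain ⟨⟨s0, s2, s3, s4, s5, s10⟩, s6, s23, s24, sD⟩ := h₂
  have e4 : clauseStart g.ψ (g.cnt (i + 1)) = clauseStart g.ψ (g.cnt i) + 1 + (g.cl i).length := by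
    rw [hc1, hcs']
  -- block 3
  refine Achieves.seqs_cons (T₁ := 3) (T₂ := 0) ?_ (fun _ h => Achieves.seqs_nil h)
  refine CliqueRed.achieves_block_of_eq (fun m' hm' => ?_) le_rfl
  simp (disch := first | omega | decide) only [execOps_cons, execOps_nil, execOp, Operand.write,
    Operand.read, merge_apply_of_lt, update_merge_of_lt, Function.update_self,
    Function.update_of_ne, BinOp.eval_add_of_lt, s4, s5, s6] at hm'
  subst hm'
  refine ⟨?_, ?_, ?_, ?_, ?_, ?_, ?_, fun a ha => ?data⟩
  case data => rw [merge_apply_of_le ha, sD a ha, hc1, hcs']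
  all_goals (try simp (disch := first | omega | decide) only [merge_apply_of_lt,
    Function.update_self, Function.update_of_ne])
  all_goals first | assumption | omega

/-! ### The outer loop -/

/-- The time of one iteration of the outer loop. [folklore] -/
def Kouter : ℕ := g.m * (g.Lx * 12 + 14) + g.Lx * 10 + 18

/-- **One input clause.** [folklore] -/
theorem outerBody_spec (hF : g.Fits W) (hk : 1 ≤ g.kM) {i : ℕ} (hi : i < g.m)
    {m : ℕ → ℕ} (h0 : g.OuterInv i m) : Achieves W O outerBody m (g.OuterInv (i + 1)) g.Kouter := by
  obtain ⟨hX, hXLx, hBv, hSv, htop, hPwV, hcMV, h2Lx, hmLx, hLyLx, hψLy, hnσ, hwsW, hWW, hwvW,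
    hPw1, hPwW, hLx3, h2n, hLywv, hwvσ, hσW, hσPw⟩ := g.facts hF hk
  obtain ⟨hcsi, hleni, hcsi'⟩ := g.cl_bounds hi
  obtain ⟨⟨r0, r2, r3, r4, r5, r10⟩, hD⟩ := h0
  have hreadi : m (g.X + clauseStart g.φ i) = (g.cl i).length := by
    rw [hD _ (by omega), g.preData_X_add _ (by omega), g.x_getD_clauseStart hi, g.cl_eq hi]
  unfold outerBody Kouter
  refine Achieves.mono (T := 5 + ((g.m * (g.Lx * 12 + 14) + 1) + ((g.Lx * 10 + 7 + 2) + (3 + 0))))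
    ?_ (fun _ h => h) (by omega)
  -- block 1
  refine Achieves.seqs_cons (R := g.ScanInv i 0) (T₁ := 5) ?_ fun m₁ h₁ => ?_
  · refine CliqueRed.achieves_block_of_eq (fun m' hm' => ?_) le_rfl
    simp (disch := first | omega | decide) only [execOps_cons, execOps_nil, execOp, Operand.write,
      Operand.read, merge_apply_of_lt, merge_apply_of_le, update_merge_of_lt, Function.update_self,
      Function.update_of_ne, BinOp.eval_add_of_lt, BinOp.eval_sub_of_le, BinOp.eval_band,
      Nat.and_self, r2, r3, hreadi] at hm'
    subst hm'
    have e7 : clauseStart g.φ (i + 1 + 0) = clauseStart g.φ i + 1 + (g.cl i).length := hcsi'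
    have e9 : (g.found i 0).toNat = 0 := by rw [found_zero]; rfl
    refine ⟨⟨?_, ?_, ?_, ?_, ?_, ?_⟩, ?_, ?_, ?_, ?_, fun a ha => ?data⟩
    case data => rw [merge_apply_of_le ha]; exact hD a ha
    all_goals (try simp (disch := first | omega | decide) only [merge_apply_of_lt,
      Function.update_self, Function.update_of_ne])
    all_goals first | assumption | omega
  -- the scan
  refine Achieves.seqs_cons (R := g.ScanInv i (g.m - (i + 1))) (T₁ := g.m * (g.Lx * 12 + 14) + 1)
    ((g.scan_loop hF hk hi h₁).mono (fun _ h => h)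
      (Nat.add_le_add_right (Nat.mul_le_mul_right _ (Nat.sub_le _ _)) 1)) fun m₂ h₂ => ?_
  obtain ⟨hB₂, s6, s7, s8, s9, sD⟩ := h₂
  rw [g.found_all hi] at s9
  -- emit or skip
  refine Achieves.seqs_cons (R := g.AfterInv i) (T₁ := g.Lx * 10 + 7 + 2) ?_ fun m₃ h₃ => ?_
  · refine Achieves.ifz (fun h9 => ?_) (fun h9 => ?_)
    · have hnot : g.φ[i]'hi ∉ g.φ.drop (i + 1) := by
        simp only [Operand.read, s9] at h9
        intro hmem; simp [hmem] at h9
      exact g.copyBlock_spec hF hk hi hnot hB₂ s6 sD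
    · have hmem : g.φ[i]'hi ∈ g.φ.drop (i + 1) := by
        simp only [Operand.read, s9] at h9
        by_contra hn; simp [hn] at h9
      have hc := cntD_succ_of_mem g.φ hi hmem
      obtain ⟨q0, q2, q3, q4, q5, q10⟩ := hB₂
      refine Achieves.skip ⟨q0, q2, q3, ?_, ?_, q10, s6, fun a ha => ?_⟩
      · rw [q4]; unfold cnt; rw [hc]
      · rw [q5]; unfold cnt; rw [hc]
      · rw [sD a ha]; unfold cnt; rw [hc]
  -- advance
  obtain ⟨q0, q2, q3, q4, q5, q10, q6, qD⟩ := h₃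
  refine Achieves.seqs_cons (T₁ := 3) (T₂ := 0) ?_ (fun _ h => Achieves.seqs_nil h)
  refine CliqueRed.achieves_block_of_eq (fun m' hm' => ?_) le_rfl
  simp (disch := first | omega | decide) only [execOps_cons, execOps_nil, execOp, Operand.write,
    Operand.read, merge_apply_of_lt, update_merge_of_lt, Function.update_self,
    Function.update_of_ne, BinOp.eval_add_of_lt, BinOp.eval_sub_of_le, q2, q3, q6] at hm'
  subst hm'
  refine ⟨⟨?_, ?_, ?_, ?_, ?_, ?_⟩, fun a ha => ?data⟩
  case data => rw [merge_apply_of_le ha]; exact qD a ha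
  all_goals (try simp (disch := first | omega | decide) only [merge_apply_of_lt,
    Function.update_self, Function.update_of_ne])
  all_goals first | assumption | omega

/-- **The deduplication loop.** [folklore] -/
theorem dedupLoop_spec (hF : g.Fits W) (hk : 1 ≤ g.kM) {m : ℕ → ℕ} (h0 : g.OuterInv 0 m) :
    Achieves W O dedupLoop m (g.OuterInv g.m) (g.m * (g.Kouter + 2) + 1) := by
  refine Achieves.whilenz g.m g.Kouter (fun i => g.OuterInv i)
    (fun i hi m' hI => ⟨?_, g.outerBody_spec hF hk hi hI⟩) (fun m' hI => ?_) h0 (fun _ h => h) le_rfl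
  · simp only [Operand.read, hI.base.r2]; omega
  · simp only [Operand.read, hI.base.r2]; omega


/-! ### Setup, header, width, environment -/

/-- **Setup.** From the relocated memory, `setupA` establishes the outer invariant at `0`.
[folklore] -/
theorem setupA_spec (hF : g.Fits W) (hk : 1 ≤ g.kM) :
    Achieves W O setupA (relocated g.x) (g.OuterInv 0) 7 := by
  obtain ⟨hX, hXLx, hBv, hSv, htop, hPwV, hcMV, h2Lx, hmLx, hLyLx, hψLy, hnσ, hwsW, hWW, hwvW,
    hPw1, hPwW, hLx3, h2n, hLywv, hwvσ, hσW, hσPw⟩ := g.facts hF hk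
  have hread : relocated g.x (g.X + 1) = g.m := by rw [relocated_X_add, x_getD_one]
  have e1 : g.X - 101 = g.Lx := by omega
  have e2 : g.Lx + g.X = g.Bv := by omega
  have e0 : g.cnt 0 = 0 := cntD_zero _
  refine CliqueRed.achieves_block_of_eq (fun m' hm' => ?_) le_rfl
  simp (disch := first | omega | decide) only [execOps_cons, execOps_nil, execOp, Operand.write,
    Operand.read, merge_apply_of_lt, merge_apply_of_le, update_merge_of_lt, Function.update_self,
    Function.update_of_ne, BinOp.eval_add_of_lt, BinOp.eval_sub_of_le, BinOp.eval_band,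
    Nat.and_self, relocated_zero', hread, e1, e2] at hm'
  subst hm'
  refine ⟨⟨?_, ?_, ?_, ?_, ?_, ?_⟩, fun a ha => ?data⟩
  case data =>
    rw [merge_apply_of_le ha, e0, clauseStart_zero, preData_two]
  all_goals (try simp (disch := first | omega | decide) only [merge_apply_of_lt,
    Function.update_self, Function.update_of_ne, relocated_zero', e0, clauseStart_zero])
  all_goals rfl

/-- Word `0` of the output is `n`. [folklore] -/
theorem y_getD_zero : g.y.getD 0 0 = g.n := by
  unfold y n; rw [List.getD_eq_getElem?_getD, encodeCNFWords_getElem?_zero, ψ, numVars_dedup]; rfl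

/-- Word `1` of the output is `|ψ|`. [folklore] -/
theorem y_getD_one : g.y.getD 1 0 = g.ψ.length := by
  unfold y; rw [List.getD_eq_getElem?_getD, encodeCNFWords_getElem?_one]; rfl

/-- **The header written**: the three header cells make the data final. [folklore] -/
theorem finData_header {m : ℕ → ℕ} (hm : ∀ a, 100 ≤ a → m a = g.preData g.Ly a)
    (a : ℕ) (ha : 100 ≤ a) :
    Function.update (Function.update (Function.update m (g.Bv + 1) g.n) (g.Bv + 2) g.ψ.length)
      g.Bv g.Ly a = g.finData a := by
  have hBv : g.Bv = g.X + g.Lx := rfl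
  have hLy := g.length_add_two_le_Ly
  unfold finData
  by_cases h0 : a = g.Bv
  · subst h0; rw [Function.update_self, if_neg (lt_irrefl _), if_pos rfl]
  rw [Function.update_of_ne h0]
  by_cases h2 : a = g.Bv + 2
  · subst h2; rw [Function.update_self, if_neg (by omega), if_neg (by omega), if_pos (by omega),
      show g.Bv + 2 - g.Bv - 1 = 1 by omega, y_getD_one]
  rw [Function.update_of_ne h2]
  by_cases h1 : a = g.Bv + 1
  · subst h1; rw [Function.update_self, if_neg (by omega), if_neg (by omega), if_pos (by omega),
      show g.Bv + 1 - g.Bv - 1 = 0 by omega, y_getD_zero]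
  rw [Function.update_of_ne h1, hm a ha]
  unfold preData
  by_cases h3 : a < g.Bv
  · rw [if_pos h3, if_pos h3]
  rw [if_neg h3, if_neg h3, if_neg h0]
  by_cases h4 : g.Bv + 3 ≤ a ∧ a < g.Bv + 1 + g.Ly
  · rw [if_pos h4, if_pos (by omega)]
  · rw [if_neg h4, if_neg (by omega)]

/-- **The header.** [folklore] -/
theorem header_spec (hF : g.Fits W) (hk : 1 ≤ g.kM) {m : ℕ → ℕ} (h0 : g.OuterInv g.m m) :
    Achieves W O header m
      (fun m' => m' 0 = g.X ∧ m' 10 = g.Bv ∧ m' 21 = g.Ly ∧ ∀ a, 100 ≤ a → m' a = g.finData a) 7 := by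
  obtain ⟨hX, hXLx, hBv, hSv, htop, hPwV, hcMV, h2Lx, hmLx, hLyLx, hψLy, hnσ, hwsW, hWW, hwvW,
    hPw1, hPwW, hLx3, h2n, hLywv, hwvσ, hσW, hσPw⟩ := g.facts hF hk
  obtain ⟨⟨r0, r2, r3, r4, r5, r10⟩, hD⟩ := h0
  have ecnt : g.cnt g.m = g.ψ.length := cntD_length _
  have ecs : clauseStart g.ψ (g.cnt g.m) = g.Ly := by rw [ecnt, clauseStart_ψ_length]
  rw [ecs] at r4 hD
  rw [ecnt] at r5
  have hreadn : m g.X = g.n := by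
    rw [hD _ (by omega), show g.X = g.X + 0 from rfl, g.preData_X_add _ (by omega), x_getD_zero]
  have e21 : g.Bv + 1 + g.Ly - g.Bv - 1 = g.Ly := by omega
  refine CliqueRed.achieves_block_of_eq (fun m' hm' => ?_) le_rfl
  simp (disch := first | omega | decide) only [execOps_cons, execOps_nil, execOp, Operand.write,
    Operand.read, merge_apply_of_lt, merge_apply_of_le, update_merge_of_lt, update_merge_of_le,
    Function.update_self, Function.update_of_ne, BinOp.eval_add_of_lt, BinOp.eval_sub_of_le,
    BinOp.eval_band, Nat.and_self, r0, r4, r5, r10, hreadn, e21] at hm'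
  subst hm'
  refine ⟨?_, ?_, ?_, fun a ha => ?data⟩
  case data => rw [merge_apply_of_le ha]; exact g.finData_header hD a ha
  all_goals (try simp (disch := first | omega | decide) only [merge_apply_of_lt,
    Function.update_self, Function.update_of_ne])
  all_goals assumption

/-- The final data at the input cell `X`: `n`. [folklore] -/
theorem finData_X : g.finData g.X = g.n := by
  unfold finData; rw [if_pos (by unfold Bv; have := g.two_le_Lx; omega),
    show g.X = g.X + 0 from rfl, relocated_X_add, x_getD_zero]

/-- **The input width.** From `r21 = Ly`, `widthPart` leaves `σ = size (max Ly (2n - 1))` in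
`r22`. [folklore] -/
theorem widthPart_spec (hF : g.Fits W) (hk : 1 ≤ g.kM) {m : ℕ → ℕ} (h0 : m 0 = g.X)
    (h10 : m 10 = g.Bv) (h21 : m 21 = g.Ly) (hD : ∀ a, 100 ≤ a → m a = g.finData a) :
    Achieves W O widthPart m
      (fun m' => m' 0 = g.X ∧ m' 10 = g.Bv ∧ m' 22 = g.σ ∧ ∀ a, 100 ≤ a → m' a = g.finData a)
      (g.σ * 4 + 10) := by
  obtain ⟨hX, hXLx, hBv, hSv, htop, hPwV, hcMV, h2Lx, hmLx, hLyLx, hψLy, hnσ, hwsW, hWW, hwvW,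
    hPw1, hPwW, hLx3, h2n, hLywv, hwvσ, hσW, hσPw⟩ := g.facts hF hk
  have hreadn : m g.X = g.n := by rw [hD _ (by omega), finData_X]
  have e31 : (if 0 < g.n + g.n then 1 else 0) ≤ g.n + g.n := by split_ifs <;> omega
  have e30 : g.n + g.n - (if 0 < g.n + g.n then 1 else 0) = 2 * g.n - 1 := by split_ifs <;> omega
  have hwv : max g.Ly (2 * g.n - 1) = g.wv := rfl
  unfold widthPart
  refine Achieves.mono (T := 5 + (3 + (1 + ((g.σ * 4 + 1) + 0)))) ?_ (fun _ h => h) (by omega)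
  -- block 1
  refine Achieves.seqs_cons (R := fun m₁ => m₁ 30 = 2 * g.n - 1 ∧
      m₁ 31 = (if g.Ly < 2 * g.n - 1 then 1 else 0) ∧ m₁ 21 = g.Ly ∧ m₁ 0 = g.X ∧ m₁ 10 = g.Bv ∧
      ∀ a, 100 ≤ a → m₁ a = g.finData a) (T₁ := 5) ?_ ?_
  · refine CliqueRed.achieves_block_of_eq (fun m' hm' => ?_) le_rfl
    simp (disch := first | assumption | omega | decide) only [execOps_cons, execOps_nil, execOp,
      Operand.write, Operand.read, merge_apply_of_lt, merge_apply_of_le, update_merge_of_lt,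
      Function.update_self, Function.update_of_ne, BinOp.eval_add_of_lt, BinOp.eval_sub_of_le,
      BinOp.eval_band, BinOp.eval_lt, Nat.and_self, h0, h21, hreadn, e30] at hm'
    subst hm'
    refine ⟨?_, ?_, ?_, ?_, ?_, fun a ha => ?data⟩
    case data => rw [merge_apply_of_le ha]; exact hD a ha
    all_goals (try simp (disch := first | omega | decide) only [merge_apply_of_lt,
      Function.update_self, Function.update_of_ne])
    all_goals assumption
  rintro m₁ ⟨q30, q31, q21, q0, q10, qD⟩
  -- the maximum
  refine Achieves.seqs_cons (R := fun m₂ => m₂ 21 = g.wv ∧ m₂ 0 = g.X ∧ m₂ 10 = g.Bv ∧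
      ∀ a, 100 ≤ a → m₂ a = g.finData a) (T₁ := 3) ?_ ?_
  · refine Achieves.ifz (fun hz => Achieves.skip ⟨?_, q0, q10, qD⟩) (fun hnz => ?_)
    · simp only [Operand.read, q31] at hz
      have hc : ¬ g.Ly < 2 * g.n - 1 := fun hc => by simp [hc] at hz
      rw [q21, ← hwv, max_eq_left (not_lt.1 hc)]
    · simp only [Operand.read, q31] at hnz
      have hlt : g.Ly < 2 * g.n - 1 := by by_contra hc; simp [hc] at hnz
      refine CliqueRed.achieves_block_of_eq (fun m' hm' => ?_) le_rfl
      simp (disch := first | omega | decide) only [execOps_cons, execOps_nil, execOp,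
        Operand.write, Operand.read, merge_apply_of_lt, update_merge_of_lt, BinOp.eval_band,
        Nat.and_self, q30] at hm'
      subst hm'
      refine ⟨?_, ?_, ?_, fun a ha => ?data⟩
      case data => rw [merge_apply_of_le ha]; exact qD a ha
      all_goals (try simp (disch := first | omega | decide) only [merge_apply_of_lt,
        Function.update_self, Function.update_of_ne])
      · rw [← hwv, max_eq_right hlt.le]
      all_goals assumption
  rintro m₂ ⟨s21, s0, s10, sD⟩
  -- clear `r22`
  refine Achieves.seqs_cons (R := fun m₃ => m₃ 22 = 0 ∧ m₃ 21 = g.wv ∧ m₃ 0 = g.X ∧ m₃ 10 = g.Bv ∧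
      ∀ a, 100 ≤ a → m₃ a = g.finData a) (T₁ := 1) ?_ ?_
  · refine CliqueRed.achieves_block_of_eq (fun m' hm' => ?_) le_rfl
    simp (disch := first | omega | decide) only [execOps_cons, execOps_nil, execOp, Operand.write,
      Operand.read, update_merge_of_lt, BinOp.eval_band, Nat.and_self] at hm'
    subst hm'
    refine ⟨?_, ?_, ?_, ?_, fun a ha => ?data⟩
    case data => rw [merge_apply_of_le ha]; exact sD a ha
    all_goals (try simp (disch := first | omega | decide) only [merge_apply_of_lt,
      Function.update_self, Function.update_of_ne])
    all_goals assumption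
  rintro m₃ ⟨t22, t21, t0, t10, tD⟩
  -- the size loop
  refine Achieves.seqs_cons (T₁ := g.σ * 4 + 1) (T₂ := 0)
    ((CliqueRed.Params.sizeLoop_spec (O := O) t21 t22 hwvW).mono (fun m₄ ⟨u22, _, uf⟩ =>
      ⟨?_, ?_, u22, fun a ha => ?_⟩) le_rfl) (fun _ h => Achieves.seqs_nil h)
  · rw [uf 0 (by omega) (by omega), t0]
  · rw [uf 10 (by omega) (by omega), t10]
  · rw [uf a (by omega) (by omega), tD a ha]

/-- **The environment.** [folklore] -/
theorem setupE_spec (hF : g.Fits W) (hk : 1 ≤ g.kM) {m : ℕ → ℕ} (h0 : m 0 = g.X)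
    (h10 : m 10 = g.Bv) (h22 : m 22 = g.σ) (hD : ∀ a, 100 ≤ a → m a = g.finData a) :
    Achieves W O (setupE g.kM g.cM) m
      (fun m' => m' 10 = g.Bv ∧ m' 11 = g.Sv ∧ m' 12 = 0 ∧ m' 13 = g.Pw ∧
        ∀ a, 100 ≤ a → m' a = g.finData a) 11 := by
  obtain ⟨hX, hXLx, hBv, hSv, htop, hPwV, hcMV, h2Lx, hmLx, hLyLx, hψLy, hnσ, hwsW, hWW, hwvW,
    hPw1, hPwW, hLx3, h2n, hLywv, hwvσ, hσW, hσPw⟩ := g.facts hF hk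
  have hreadn : m g.X = g.n := by rw [hD _ (by omega), finData_X]
  have ews : (g.n + g.σ) * g.kM = g.ws := by unfold ws; exact Nat.mul_comm _ _
  have hmul : (g.n + g.σ) * g.kM < 2 ^ W := by rw [ews]; omega
  have hPw : 2 ^ g.ws = g.Pw := rfl
  have hshl : 1 * 2 ^ g.ws < 2 ^ W := by rw [Nat.one_mul, hPw]; exact hPwW
  have hnσW : g.n + g.σ < 2 ^ W := by omega
  unfold setupE
  refine Achieves.mono (T := 5 + (3 + (3 + 0))) ?_ (fun _ h => h) (by omega)
  -- block 1
  refine Achieves.seqs_cons (R := fun m₁ => m₁ 13 = g.Pw ∧ m₁ 23 = g.Pw - 1 ∧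
      m₁ 24 = (if g.Pw - 1 < g.cM then 1 else 0) ∧ m₁ 10 = g.Bv ∧
      ∀ a, 100 ≤ a → m₁ a = g.finData a) (T₁ := 5) ?_ ?_
  · refine CliqueRed.achieves_block_of_eq (fun m' hm' => ?_) le_rfl
    simp (disch := first | assumption | omega | decide) only [execOps_cons, execOps_nil, execOp,
      Operand.write, Operand.read, merge_apply_of_lt, merge_apply_of_le, update_merge_of_lt,
      Function.update_self, BinOp.eval_add_of_lt, BinOp.eval_sub_of_le,
      BinOp.eval_mul_of_lt, BinOp.eval_shl_of_lt, BinOp.eval_lt, Nat.one_mul, h0, h22, hreadn,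
      ews, hPw] at hm'
    subst hm'
    refine ⟨?_, ?_, ?_, ?_, fun a ha => ?data⟩
    case data => rw [merge_apply_of_le ha]; exact hD a ha
    all_goals (try simp (disch := first | omega | decide) only [merge_apply_of_lt,
      Function.update_self, Function.update_of_ne])
    all_goals assumption
  rintro m₁ ⟨q13, q23, q24, q10, qD⟩
  -- the maximum
  refine Achieves.seqs_cons (R := fun m₂ => m₂ 23 = g.V ∧ m₂ 13 = g.Pw ∧ m₂ 10 = g.Bv ∧
      ∀ a, 100 ≤ a → m₂ a = g.finData a) (T₁ := 3) ?_ ?_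
  · refine Achieves.ifz (fun hz => Achieves.skip ⟨?_, q13, q10, qD⟩) (fun hnz => ?_)
    · simp only [Operand.read, q24] at hz
      have hc : ¬ g.Pw - 1 < g.cM := fun hc => by simp [hc] at hz
      rw [q23]; unfold V; rw [max_eq_left (not_lt.1 hc)]
    · simp only [Operand.read, q24] at hnz
      have hlt : g.Pw - 1 < g.cM := by by_contra hc; simp [hc] at hnz
      refine CliqueRed.achieves_block_of_eq (fun m' hm' => ?_) le_rfl
      simp (disch := first | omega | decide) only [execOps_cons, execOps_nil, execOp,
        Operand.write, Operand.read, update_merge_of_lt, BinOp.eval_band, Nat.and_self] at hm'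
      subst hm'
      refine ⟨?_, ?_, ?_, fun a ha => ?data⟩
      case data => rw [merge_apply_of_le ha]; exact qD a ha
      all_goals (try simp (disch := first | omega | decide) only [merge_apply_of_lt,
        Function.update_self, Function.update_of_ne])
      · unfold V; rw [max_eq_right hlt.le]
      all_goals assumption
  rintro m₂ ⟨s23, s13, s10, sD⟩
  -- block 3
  refine Achieves.seqs_cons (T₁ := 3) (T₂ := 0) ?_ (fun _ h => Achieves.seqs_nil h)
  refine CliqueRed.achieves_block_of_eq (fun m' hm' => ?_) le_rfl
  simp (disch := first | omega | decide) only [execOps_cons, execOps_nil, execOp, Operand.write,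
    Operand.read, merge_apply_of_lt, update_merge_of_lt, Function.update_self,
    BinOp.eval_add_of_lt, BinOp.eval_band, Nat.and_self, s23, s10] at hm'
  subst hm'
  refine ⟨?_, ?_, ?_, ?_, fun a ha => ?data⟩
  case data => rw [merge_apply_of_le ha]; exact sD a ha
  all_goals (try simp (disch := first | omega | decide) only [merge_apply_of_lt,
    Function.update_self, Function.update_of_ne])
  all_goals assumption

/-! ### The whole build -/

/-- The time of the build. [folklore] -/
def Tpre : ℕ := 7 * g.Lx + 7 + (g.m * (g.Kouter + 2) + 1) + 7 + (g.σ * 4 + 10) + 11 + 96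

/-- **The build.** On the initial memory of `x = encodeCNFWords φ` (word size `W` with
`g.Fits W`, `kM ≥ 1`), `pre` ends, within `Tpre` steps, in the closed-form memory `finMem`.
[folklore] -/
theorem pre_spec (hF : g.Fits W) (hk : 1 ≤ g.kM) :
    Achieves W O (pre g.kM g.cM) (initFun g.x) (fun m => m = g.finMem) g.Tpre := by
  obtain ⟨hX, hXLx, hBv, hSv, htop, hPwV, hcMV, h2Lx, hmLx, hLyLx, hψLy, hnσ, hwsW, hWW, hwvW,
    hPw1, hPwW, hLx3, h2n, hLywv, hwvσ, hσW, hσPw⟩ := g.facts hF hk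
  unfold pre Tpre
  refine Achieves.mono (T := 7 * g.Lx + (7 + ((g.m * (g.Kouter + 2) + 1) + (7 + ((g.σ * 4 + 10) +
    (11 + (96 + 0))))))) ?_ (fun _ h => h) (by omega)
  -- relocate
  refine Achieves.seqs_cons (R := fun m => m = relocated g.x) (T₁ := 7 * g.Lx)
    (fun qs => ⟨relocated g.x, 7 * g.Lx, le_rfl, ?_, rfl⟩) ?_
  · have h2 := g.two_le_Lx
    unfold Lx at h2 hLx3
    exact relocate_exec (by omega) hF.input (by omega) qs
  rintro m rfl
  -- setup, deduplication, header, width, environment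
  refine Achieves.seqs_cons (g.setupA_spec hF hk) fun m₁ h₁ => ?_
  refine Achieves.seqs_cons (g.dedupLoop_spec hF hk h₁) fun m₂ h₂ => ?_
  refine Achieves.seqs_cons (g.header_spec hF hk h₂) ?_
  rintro m₃ ⟨a0, a10, a21, aD⟩
  refine Achieves.seqs_cons (g.widthPart_spec hF hk a0 a10 a21 aD) ?_
  rintro m₄ ⟨b0, b10, b22, bD⟩
  refine Achieves.seqs_cons (g.setupE_spec hF hk b0 b10 b22 bD) ?_
  rintro m₅ ⟨c10, c11, c12, c13, cD⟩
  -- clearing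
  refine Achieves.seqs_cons (T₁ := 96) (T₂ := 0) ?_ fun _ h => Achieves.seqs_nil h
  refine Achieves.block ?_ (by rw [List.length_map, CliqueRed.length_clearedRegs])
  show execOps W m₅ (CliqueRed.clearedRegs.map fun i =>
    ((.band, CliqueRed.r i, CliqueRed.im 0, CliqueRed.im 0) : OpSpec)) = g.finMem
  rw [CliqueRed.execOps_clear]
  funext a
  unfold finMem
  simp only [CliqueRed.mem_clearedRegs]
  by_cases ha : a < 100
  · rw [if_pos ha]
    by_cases h10 : a = 10; · subst h10; simp [c10]
    by_cases h11 : a = 11; · subst h11; simp [c11]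
    by_cases h12 : a = 12; · subst h12; simp [c12]
    by_cases h13 : a = 13; · subst h13; simp [c13]
    rw [if_pos ⟨ha, by omega⟩, if_neg h10, if_neg h11, if_neg h13]
  · rw [if_neg (by omega), if_neg ha, cD a (by omega)]


/-! ### The run: emulator side conditions, the final memory, the read-out -/

/-- The emulator's side conditions hold for the layout and the environment. [folklore] -/
theorem envOK (hF : g.Fits W) (hk : 1 ≤ g.kM) : EnvOK CliqueRed.lay g.env W := by
  obtain ⟨hX, hXLx, hBv, hSv, htop, hPwV, hcMV, h2Lx, hmLx, hLyLx, hψLy, hnσ, hwsW, hWW, hwvW,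
    hPw1, hPwW, hLx3, h2n, hLywv, hwvσ, hσW, hσPw⟩ := g.facts hF hk
  refine ⟨by decide, by decide, by decide, by decide, by decide, by decide, by decide,
    fun r hr => ?_, Or.inl ?_, ?_, ?_, hwsW.le⟩
  · simp only [CliqueRed.lay, Layout.regs, List.mem_cons, List.not_mem_nil, or_false] at hr
    show r < g.Bv ∧ r < g.Sv
    rcases hr with rfl | rfl | rfl | rfl | rfl | rfl | rfl <;> omega
  · show g.Bv + (g.V + 1) ≤ g.Sv; omega
  · show g.Bv + (g.V + 1) ≤ 2 ^ W; omega
  · show g.Sv + (g.V + 1) ≤ 2 ^ W; omega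

/-- The words of the emulated input are below `2 ^ σ`. [folklore] -/
theorem y_word_lt {v : ℕ} (hv : v ∈ g.y) : v < 2 ^ g.σ := by
  rw [sigma_eq]; exact lt_two_pow_inputWidth_of_mem _ _ hv

/-- Every cell of the final memory is below `2 ^ W`. [folklore] -/
theorem finMem_lt (hF : g.Fits W) (hk : 1 ≤ g.kM) (a : ℕ) : g.finMem a < 2 ^ W := by
  obtain ⟨hX, hXLx, hBv, hSv, htop, hPwV, hcMV, h2Lx, hmLx, hLyLx, hψLy, hnσ, hwsW, hWW, hwvW,
    hPw1, hPwW, hLx3, h2n, hLywv, hwvσ, hσW, hσPw⟩ := g.facts hF hk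
  unfold finMem
  by_cases ha : a < 100
  · rw [if_pos ha]; split_ifs <;> omega
  rw [if_neg ha]
  unfold finData
  split_ifs with h1 h2 h3
  · exact lt_of_le_of_lt (CliqueRed.relocated_le_of_forall (B := 2 ^ W - 1)
      (fun v hv => Nat.le_sub_one_of_lt (hF.input v hv)) (by omega)) (by omega)
  · omega
  · rw [List.getD_eq_getElem?_getD]
    cases h : g.y[a - g.Bv - 1]? with
    | none => simp
    | some v => simpa using lt_trans (g.y_word_lt (List.mem_of_getElem? h)) hσW
  · exact Nat.two_pow_pos W

/-- Above `Bv + Ly` the final memory is `0`; in particular all stamps are `0`. [folklore] -/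
theorem finMem_Sv_add (hF : g.Fits W) (hk : 1 ≤ g.kM) (a : ℕ) : g.finMem (g.Sv + a) = 0 := by
  obtain ⟨hX, hXLx, hBv, hSv, htop, hPwV, hcMV, h2Lx, hmLx, hLyLx, hψLy, hnσ, hwsW, hWW, hwvW,
    hPw1, hPwW, hLx3, h2n, hLywv, hwvσ, hσW, hσPw⟩ := g.facts hF hk
  unfold finMem finData
  rw [if_neg (show ¬ g.Sv + a < 100 by omega), if_neg (show ¬ g.Sv + a < g.Bv by omega),
    if_neg (show ¬ g.Sv + a = g.Bv by omega), if_neg (show ¬ g.Sv + a ≤ g.Bv + g.Ly by omega)]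

/-- **The target invariant at the end of the build.** [folklore] -/
theorem tinv_finMem (hF : g.Fits W) (hk : 1 ≤ g.kM) : TInv CliqueRed.lay g.env (2 ^ W - 1) g.finMem := by
  refine ⟨⟨?_, ?_, ?_, ?_⟩, fun a _ => ?_, fun a => Nat.le_sub_one_of_lt (g.finMem_lt hF hk a)⟩
  · show g.finMem 10 = g.Bv; simp [finMem]
  · show g.finMem 11 = g.Sv; simp [finMem]
  · show g.finMem 12 = 0; simp [finMem]
  · show g.finMem 13 = 2 ^ g.ws; simp [finMem]; rfl
  · show g.finMem (g.Sv + a) ≤ 0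
    rw [g.finMem_Sv_add hF hk a]

/-- **The emulated input is in place at the end of the build**: the emulated memory is the
initial memory of the sparse-`k`-SAT program on `y` at word size `ws`. [folklore] -/
theorem agree_finMem (hF : g.Fits W) (hk : 1 ≤ g.kM) : Agree g.env g.finMem (init g.ws g.y).mem := by
  obtain ⟨hX, hXLx, hBv, hSv, htop, hPwV, hcMV, h2Lx, hmLx, hLyLx, hψLy, hnσ, hwsW, hWW, hwvW,
    hPw1, hPwW, hLx3, h2n, hLywv, hwvσ, hσW, hσPw⟩ := g.facts hF hk
  have hinit : (init g.ws g.y).mem = initFun g.y :=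
    init_mem_eq_initFun (by rw [← sigma_eq]; omega)
  rw [hinit]
  intro a _
  show (if g.finMem (g.Sv + a) = 0 then g.finMem (g.Bv + a) else 0) = initFun g.y a
  rw [if_pos (g.finMem_Sv_add hF hk a)]
  unfold finMem finData initFun
  rw [if_neg (show ¬ g.Bv + a < 100 by omega), if_neg (show ¬ g.Bv + a < g.Bv by omega)]
  rcases Nat.eq_zero_or_pos a with rfl | hpos
  · rw [Nat.add_zero, if_pos rfl, if_pos rfl]; rfl
  · rw [if_neg (show ¬ g.Bv + a = g.Bv by omega), if_neg (show a ≠ 0 by omega)]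
    by_cases hle : a ≤ g.Ly
    · rw [if_pos (show g.Bv + a ≤ g.Bv + g.Ly by omega),
        show g.Bv + a - g.Bv - 1 = a - 1 by omega]
    · rw [if_neg (show ¬ g.Bv + a ≤ g.Bv + g.Ly by omega),
        List.getD_eq_default _ _ (by unfold Ly at hle; omega)]

/-- **The read-out.** From any memory agreeing with the halting memory `dm` of the emulated
program (target invariant kept), `post` outputs `[dm 1]` in `3` steps. [folklore] -/
theorem post_spec (hF : g.Fits W) (hk : 1 ≤ g.kM) {m₂ dm : ℕ → ℕ} (hag : Agree g.env m₂ dm)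
    (hI : TInv CliqueRed.lay g.env (2 ^ W - 1) m₂) (qs : List (List ℕ)) :
    ∃ (st₃ : Store) (t₃ : ℕ), t₃ ≤ 3 ∧ Exec W O CliqueRed.post ⟨m₂, qs⟩ st₃ t₃ ∧
      readOut st₃.mem = [dm 1] := by
  obtain ⟨hX, hXLx, hBv, hSv, htop, hPwV, hcMV, h2Lx, hmLx, hLyLx, hψLy, hnσ, hwsW, hWW, hwvW,
    hPw1, hPwW, hLx3, h2n, hLywv, hwvσ, hσW, hσPw⟩ := g.facts hF hk
  have h10 : m₂ 10 = g.Bv := hI.env.1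
  have hst : m₂ (g.Sv + 1) = 0 := Nat.le_zero.1 (hI.stamp 1 (by show 1 < g.V + 1; omega))
  have h1 : m₂ (g.Bv + 1) = dm 1 := by
    have := hag 1 (by show 1 < g.V + 1; omega)
    simp only [edec, Params.env, hst, if_true] at this
    exact this
  refine ⟨_, 3, le_rfl, Exec.block _ m₂ qs, ?_⟩
  have hm : execOps W m₂ [(.add, CliqueRed.r 17, CliqueRed.r 10, CliqueRed.im 1),
      (.band, CliqueRed.r 1, CliqueRed.pt 17, CliqueRed.pt 17),
      (.band, CliqueRed.r 0, CliqueRed.im 1, CliqueRed.im 1)] =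
      Function.update (Function.update (Function.update m₂ 17 (g.Bv + 1)) 1 (dm 1)) 0 1 := by
    simp (disch := first | omega | decide) only [execOps_cons, execOps_nil, execOp, Operand.write,
      Operand.read, Function.update_self, Function.update_of_ne, h10, BinOp.eval_add_of_lt,
      BinOp.eval_band, Nat.and_self]
    rw [h1]
  show readOut (execOps W m₂ _) = _
  rw [hm]
  simp [readOut, readSeg, Function.update_self, Function.update_of_ne]

/-- The total time of the wrapper, given a time bound `T` for the emulated program. [folklore] -/
def Ttotal (T : ℕ) : ℕ := g.Tpre + cstep * T + 4

/-- **The wrapper's output.** At a word size `W` with `g.Fits W` and `kM ≥ 1`, if the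
deterministic oracle-free program `M` (largest constant `cM`) outputs `[bit]` on
`y = encodeCNFWords (dedup φ)` at word size `ws = kM · (n + inputWidth y)` within `T` steps,
then the wrapper outputs `[bit]` on `x = encodeCNFWords φ` within `Tpre + 38 T + 4` steps.
[folklore] -/
theorem wrapper_outputsWithin (hF : g.Fits W) (hk : 1 ≤ g.kM) {M : Program}
    (hdet : M.IsDeterministic) (hof : M.IsOracleFree) (hcM : M.maxConst = g.cM) {T bit : ℕ}
    (hM : OutputsWithin M g.ws noOracle zeroCoins g.y [bit] T) :
    OutputsWithin (wrapper M g.kM) W noOracle zeroCoins g.x [bit] (g.Ttotal T) := by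
  obtain ⟨hX, hXLx, hBv, hSv, htop, hPwV, hcMV, h2Lx, hmLx, hLyLx, hψLy, hnσ, hwsW, hWW, hwvW,
    hPw1, hPwW, hLx3, h2n, hLywv, hwvσ, hσW, hσPw⟩ := g.facts hF hk
  obtain ⟨st₁, t₁, ht₁, hexec, hmem, hqs⟩ := (g.pre_spec (O := noOracle) hF hk).exists_exec
  obtain ⟨dh, hhalt, hout⟩ := (outputsWithin_iff_exists_haltsWithin _ _ _ _ _ _ _).1 hM
  have hst₁ : st₁ = ⟨g.finMem, []⟩ := by cases st₁; simp only at hmem hqs; rw [hmem, hqs]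
  subst hst₁
  unfold wrapper
  rw [hcM]
  have key := outputsWithin_withSubrun (O := noOracle) zeroCoins (pre := pre g.kM g.cM)
    (post := CliqueRed.post) (L := CliqueRed.lay) (E := g.env) (VT := 2 ^ W - 1) (V := g.V) (M := M)
    (x := g.x) (y := g.y) (out := [bit]) (T₂ := 3) hF.width hexec (g.envOK hF hk) (by omega)
    (by omega)
    (fun r hr => by
      simp only [CliqueRed.lay, Layout.regs, List.mem_cons, List.not_mem_nil, or_false] at hr
      rcases hr with rfl | rfl | rfl | rfl | rfl | rfl | rfl <;> omega)
    hdet hof (by rw [hcM]; exact hcMV) (by show g.V < g.V + 1; omega) (by omega)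
    (by show 2 ^ g.ws - 1 ≤ g.V; unfold Params.V Params.Pw; omega) (by omega)
    (g.tinv_finMem hF hk) (g.agree_finMem hF hk) hhalt
    (fun m₂ hag hI _ => by
      have := g.post_spec (O := noOracle) hF hk hag hI []
      rwa [CliqueRed.mem_one_of_readOut hout] at this)
  exact key.mono (by unfold Ttotal; omega)

end Params

end DedupWrap

end Literature.Computability.FineGrained
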